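import Literature.NumberTheory.LFunctions.ExplicitPageRepulsionStechkin
import HarnessLib

/-!
# McCurley's explicit region for Dirichlet `L`-functions: the real-zero clause of Theorem 1, PROVED

Topic `Literature/NumberTheory/LFunctions` (namespace `Literature.NumberTheory.LFunctions`;
sub-namespace `McCurleyStechkin`, continuing `ExplicitLandauRepulsionStechkin.lean` and
`ExplicitPageRepulsionStechkin.lean`). Everything here is PROVED (standard axioms); the `def`s
(`rsA0 … rsA4`, `rsCoeff`, `rsA234`, `eulerCorrC`, `uCorr`, `corrC`, `gPen`, `tPen`, `rOpt`) are
definitions with bodies; NO named fact is introduced.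

Source: K. S. McCurley, *Explicit zero-free regions for Dirichlet L-functions*, J. Number Theory
**19** (1984) 7–32 [McCurley1984ZFR], **Theorem 1** (p. 8, page image checked by the tree, see
`ZeroFreeRegionUpTo.lean`): "Let `M = max{k, k|t|, 10}` and `R = 9.645908801`. Then `𝓛_k(s)` has
at most a single zero in the region `{s : σ ⩾ 1 − 1/(R log M)}`. The only possible zero in this
region is a simple real zero arising from an `L`-function formed with a real non-principal
character modulo `k`." The tree vendors this as the named fact `McCurley1984_theorem1_closed =
AtMostOneZeroInClosedRegion 9.645908801 10` (all `q ≥ 3`, pairs `(χ, s)` with `s ≠ 1`).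

## Main results

* `mccurley1984_theorem1_realZeros` — **the real-zero clause of Theorem 1 as a theorem**: for
  `q ≥ 3`, characters `χ₁, χ₂` mod `q`, real `s₁, s₂ ≠ 1` with `1 − 1/(R log max(q,10)) ≤ sᵢ` and
  `L(sᵢ, χᵢ) = 0`: `(χ₁, s₁) = (χ₂, s₂)`, `χ₁ ≠ χ₀`, `χ₁² = χ₀`;
  `mccurley1984_theorem1_closed_of_im_eq_zero` — literally the statement of
  `McCurley1984_theorem1_closed` with the two extra hypotheses `Im s₁ = Im s₂ = 0`.
  Every consumer of `McCurley1984_theorem1{,_closed}` in the tree that evaluates the fact at real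
  points only (`BGTZ2025.HypothesisB`, `no_landauSiegelZero_upTo_*`, …) is served by these.
* `McCurleyStechkin.realZero_lt_of_sq_ne_one` — **no real zero for COMPLEX characters in the
  window**: `χ` mod `q` with `χ² ≠ χ₀`, `β > 0`, `L(β, χ) = 0` ⇒ `β < 1 − 1/(R log max(q,10))`
  (`realZero_lt_of_sq_ne_one_primitive` for primitive `χ`; reduction through the Euler factors of
  `LFunction_changeLevel`); `McCurleyStechkin.quadratic_of_realZero_window` — a real zero `β ≠ 1` in
  the window forces `χ ≠ χ₀`, `χ² = χ₀`, `0 < β < 1` (principal character: `ζ ≠ 0` on `(0,1)`,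
  the tree's `riemannZeta_ne_zero_of_mem_Ioo_holds`, and Mathlib's non-vanishing on `Re s ≥ 1`).
  The real characters are then handled by the tree's `McCurleyStechkin.realZeros_quadratic_sameModulus`
  (McCurley's Theorem 2 discharged; Page window `1 − 0.155/log q ⊇` McCurley's window).

NOT proved here: the clauses of Theorem 1 about complex zeros `t ≠ 0` (McCurley §4–§5: the
Gamma-factor Lemmas 1–2 on vertical lines, Lemmas 5–7, the casework in `|γ|`), so the named fact
`McCurley1984_theorem1_closed` itself stays a fact.

## The printed proof and what is proved here (McCurley §2, §4 (27)–(30), §5 ¶1, (36)–(37))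

For a complex primitive `χ` mod `k` and a real zero `β`, McCurley's inequality (27) at `t = 0` reads
`Σₙ Λ(n) n^{−σ}(1 − κ n^{σ−σ₁}) P(arg χ(n)) ≥ 0` with the Rosser–Schoenfeld polynomial
`P(θ) = 8(0.9126 + cos θ)²(0.2766 + cos θ)² = Σ_{m=0}^{4} aₘ cos mθ`
(`a₀ = 11.1859355312082048`, `a₁ = 19.073344004352`, `a₂ = 11.67618784`, `a₃ = 4.7568`, `a₄ = 1`,
§2 p. 10; the expansion is an exact identity, `rosserPoly_expand`), i.e.
`0 ≤ Σₘ aₘ f_{χᵐ}(σ)` with `f_ψ(σ) = Re(−L'/L(σ,ψ)) − κ Re(−L'/L(σ₁,ψ))` (`rosser_positivity`).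
Each index is bounded above (all at REAL points `1 < σ ≤ 1.3`, with the constants already proved in
`ExplicitLandauRepulsionStechkin.lean`: `f_ζ ≤ 1/(σ−1) − 0.325` for McCurley's `−0.7833`, Gamma
terms `≤ −0.44` for his `d(a,m) − K log π`):
* `χᵐ = χ₀` (`m = 0`, and `m = ord χ`): `f = f_ζ − s_k(σ)`, `s_k = Σ_{p∣k} log p [u/(1−u) − κu₁/(1−u₁)]`,
  `u = p^{−σ}`, `u₁ = p^{−σ₁}` (`fdiff_principal_eq`, through `LFunction_changeLevel` from level `1`);
* `χᵐ ∈ {χ, χ̄}` (primitive mod `k`, carrying the zero `β`): `f ≤ K log k − 0.44 − 1/(σ−β)`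
  (`fdiff_zero_le`: the Stechkin-differenced pair-Hadamard bound with the real zero kept, Lemma 4's
  second clause `P(σ,β) ≥ 1/(σ−β)` = `inv_sub_le_stechkinPair`);
* otherwise (`χᵐ ≠ χ₀` induced by `ψ₁` mod `d`): `f ≤ K log k − 0.44 + Σ_{p∣k} max(G(p,σ),0)`,
  `G = U(p,σ) + κU(p,σ₁) − K log p`, `U(p,t) = log p/(pᵗ − 1)` (`fdiff_induced_le`: McCurley's
  `T(k,k₁)`, here with the complex Euler factors `1 − ψ₁(p)p^{−s}` — `logDeriv_eulerFactorC`,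
  `|e(w,p,t)| ≤ log p·u/(1−u)` — and `K log d ≤ K log k − K Σ_{p∣k, p∤d} log p`).
The per-prime totals `T(p,σ) = (a₂+a₃+a₄) max(G,0) − a₀[U − κU₁]` are `≤ 0` for `p ≥ 7` and
`≤ 9.36, 6.33, 0.5` for `p = 2, 3, 5` (`sum_tPen_le`: `≤ 16.19`; McCurley's (37) has `6.276` with his
sharper `T`), so that, by order of `χ` (`χ³ = χ₀`: `χ² = χ̄`, `χ⁴ = χ`; `χ⁴ = χ₀`: `χ³ = χ̄`;
`χ⁵ = χ₀`: `χ⁴ = χ̄`; generic), `c/(σ−β) ≤ P₀/(σ−1) + K·A'·log k + C` with `C < 0`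
(`assembled_order_three/_four/_five`, `assembled_generic`; generic: `c = a₁`, `P₀ = a₀`,
`A' = A = a₁+a₂+a₃+a₄ = 36.506331844352`). With `σ = 1 + r/L`, `L = log max(k,10)` and
`β ≥ 1 − (1/R)/L` this is impossible as soon as `c/(r + 1/R) > P₀/r + K·A'` (`endgame_contra`).
For the generic case this is exactly McCurley's "(30) ⇒ `β < 1 − (a₁r/(a₀+κAr) − r)/log M`; if we
choose `r = 0.33901`, then `a₁r/(a₀+κAr) − r > 1/R`": the optimum is `1/R* = (√a₁ − √a₀)²/(K·A)`,
`R* = 9.645 908 800 268…`, and the printed `R = 9.645908801` is `R*` rounded up in the tenth digit,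
so the kernel inequality (`numeric_generic`, with `r = 0.339013351753` and `√5` to 19 decimals) has a
margin of `7.9·10⁻¹²` (McCurley's `r = 0.33901` leaves `1.1·10⁻¹³`). The other orders have margins
`> 0.02` (`numeric_order_three/_four/_five`). The floor `M₀ = 10` is what makes `σ = 1 + r/log M ≤ 1.15`.

Deviations from print (recorded): constants `0.325/0.44/16.19` for McCurley's `0.7833+s(k)`/
`d(a,m)`-table/`6.276` (cruder, sufficient: the slack at `t = 0` is `≈ 3` after all losses); the
imprimitive corrections are bounded in absolute value for complex `ψ₁(p)`; the cases `χ³ = χ₀`,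
`χ⁴ = χ₀` are done with `P` and the extra zero-carrying powers instead of McCurley's §6 inequalities
(43)/(46) (which serve `γ ≠ 0` small).

## References

* K. S. McCurley, J. Number Theory 19 (1984) 7–32, doi:10.1016/0022-314x(84)90089-1: Theorem 1
  (p. 8), §2 (pp. 9–10: `P`, `aₘ`, `A`, `K`, `σ₁`, `s(k)`, `T(k,k₁)`), Lemmas 3, 4, 6, 8–10,
  §4 (27)–(30) (p. 22–23), §5 first display (p. 26), (36)–(37) (p. 25). [McCurley1984ZFR]
* J. B. Rosser, L. Schoenfeld, Math. Comp. 29 (1975) 243–269 (the polynomial `P` and `R`).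
  [RosserSchoenfeld1975]
* H. L. Montgomery, R. C. Vaughan, *Multiplicative Number Theory I*, §10.1, (4.25).
  [MontgomeryVaughan2007]
-/

noncomputable section

open Real Complex

namespace Literature.NumberTheory.LFunctions

namespace McCurleyStechkin

/-! ## The Rosser–Schoenfeld polynomial `P(θ) = 8(0.9126 + cos θ)²(0.2766 + cos θ)² = Σ aₘ cos mθ` -/

/-- `a₀ = 11.1859355312082048`. [cite: McCurley1984ZFR, §2 p. 10] -/
def rsA0 : ℝ := 11.1859355312082048
/-- `a₁ = 19.073344004352`. [cite: McCurley1984ZFR, §2 p. 10] -/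
def rsA1 : ℝ := 19.073344004352
/-- `a₂ = 11.67618784`. [cite: McCurley1984ZFR, §2 p. 10] -/
def rsA2 : ℝ := 11.67618784
/-- `a₃ = 4.7568`. [cite: McCurley1984ZFR, §2 p. 10] -/
def rsA3 : ℝ := 4.7568
/-- `a₄ = 1`. [cite: McCurley1984ZFR, §2 p. 10] -/
def rsA4 : ℝ := 1

/-- The coefficient list `m ↦ aₘ` (`0` beyond degree `4`). [cite: McCurley1984ZFR, §2 p. 10] -/
def rsCoeff : ℕ → ℝ
  | 0 => rsA0
  | 1 => rsA1
  | 2 => rsA2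
  | 3 => rsA3
  | 4 => rsA4
  | _ => 0

/-- **The cosine expansion of the Rosser–Schoenfeld polynomial** (exact identity in `c = cos θ`,
`cos 2θ = 2c² − 1`, `cos 3θ = 4c³ − 3c`, `cos 4θ = 8c⁴ − 8c² + 1`):
`a₀ + a₁ c + a₂(2c²−1) + a₃(4c³−3c) + a₄(8c⁴−8c²+1) = 8(0.9126 + c)²(0.2766 + c)²`.
[cite: McCurley1984ZFR, §2 p. 9–10] -/
theorem rosserPoly_expand (c : ℝ) :
    rsA0 + rsA1 * c + rsA2 * (2 * c ^ 2 - 1) + rsA3 * (4 * c ^ 3 - 3 * c)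
      + rsA4 * (8 * c ^ 4 - 8 * c ^ 2 + 1) = 8 * (0.9126 + c) ^ 2 * (0.2766 + c) ^ 2 := by
  simp only [rsA0, rsA1, rsA2, rsA3, rsA4]
  ring

/-- Non-negativity of the expansion. [cite: McCurley1984ZFR, §2 p. 9] -/
theorem rosserPoly_nonneg (c : ℝ) :
    0 ≤ rsA0 + rsA1 * c + rsA2 * (2 * c ^ 2 - 1) + rsA3 * (4 * c ^ 3 - 3 * c)
      + rsA4 * (8 * c ^ 4 - 8 * c ^ 2 + 1) := by
  rw [rosserPoly_expand]; positivity

/-- Chebyshev: `Re z² = 2(Re z)² − 1` on the unit circle (`cos 2θ = 2cos²θ − 1`).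
[cite: McCurley1984ZFR, §2 p. 9–10] -/
theorem re_pow_two_of_unit {z : ℂ} (h : z.re ^ 2 + z.im ^ 2 = 1) : (z ^ 2).re = 2 * z.re ^ 2 - 1 := by
  simp only [pow_succ, pow_zero, one_mul, Complex.mul_re]
  linear_combination (-1 : ℝ) * h

/-- Chebyshev: `Re z³ = 4(Re z)³ − 3 Re z` on the unit circle (`cos 3θ`). [cite: McCurley1984ZFR, §2 p. 9–10] -/
theorem re_pow_three_of_unit {z : ℂ} (h : z.re ^ 2 + z.im ^ 2 = 1) :
    (z ^ 3).re = 4 * z.re ^ 3 - 3 * z.re := by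
  simp only [pow_succ, pow_zero, one_mul, Complex.mul_re, Complex.mul_im]
  linear_combination (-3 * z.re) * h

/-- Chebyshev: `Re z⁴ = 8(Re z)⁴ − 8(Re z)² + 1` on the unit circle (`cos 4θ`).
[cite: McCurley1984ZFR, §2 p. 9–10] -/
theorem re_pow_four_of_unit {z : ℂ} (h : z.re ^ 2 + z.im ^ 2 = 1) :
    (z ^ 4).re = 8 * z.re ^ 4 - 8 * z.re ^ 2 + 1 := by
  simp only [pow_succ, pow_zero, one_mul, Complex.mul_re, Complex.mul_im]
  linear_combination (z.im ^ 2 - 7 * z.re ^ 2 + 1) * h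

/-- **`Σ aₘ Re(zᵐ) = P(arg z) ≥ 0` for `|z| = 1`.** [cite: McCurley1984ZFR, §4 (27)] -/
theorem rosserSum_nonneg_of_norm_eq_one {z : ℂ} (hz : ‖z‖ = 1) :
    0 ≤ rsA0 * (z ^ 0).re + rsA1 * (z ^ 1).re + rsA2 * (z ^ 2).re + rsA3 * (z ^ 3).re
      + rsA4 * (z ^ 4).re := by
  have h : z.re ^ 2 + z.im ^ 2 = 1 := by
    have := Complex.normSq_apply z
    rw [Complex.normSq_eq_norm_sq, hz] at this
    nlinarith [this]
  rw [pow_zero, Complex.one_re, pow_one, re_pow_two_of_unit h, re_pow_three_of_unit h,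
    re_pow_four_of_unit h, mul_one]
  exact rosserPoly_nonneg z.re


/-! ## Positivity: `0 ≤ Σₘ aₘ f_{χᵐ}(σ)` (McCurley's (27) at `t = 0`) -/

section Positivity

open LSeries ArithmeticFunction DirichletCharacter

variable {k : ℕ} [NeZero k]

/-- For every residue `a` mod `k`: `0 ≤ Σₘ aₘ Re((χᵐ)(a))` (`= P(arg χ(a))` if `a` is a unit,
`= 0` otherwise). [cite: McCurley1984ZFR, §4 (27)] -/
theorem rosserSum_char_nonneg (χ : DirichletCharacter ℂ k) (a : ZMod k) :
    0 ≤ rsA0 * ((χ ^ 0) a).re + rsA1 * ((χ ^ 1) a).re + rsA2 * ((χ ^ 2) a).re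
      + rsA3 * ((χ ^ 3) a).re + rsA4 * ((χ ^ 4) a).re := by
  by_cases ha : IsUnit a
  · obtain ⟨u, rfl⟩ := ha
    simp only [MulChar.pow_apply_coe]
    exact rosserSum_nonneg_of_norm_eq_one (χ.unit_norm_eq_one u)
  · simp only [MulChar.map_nonunit _ ha, Complex.zero_re, mul_zero, add_zero, le_refl]

/-- **McCurley's (27) at a real point.** For any Dirichlet character `χ` mod `k` and real `σ > 1`:
`0 ≤ Σ_{m=0}^{4} aₘ f_{χᵐ}(σ)`, `f_ψ(σ) = Re(−L'/L(σ,ψ)) − κ Re(−L'/L(σ₁,ψ))`, `χ⁰ = χ₀` — the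
combined Dirichlet series is `Σₙ Λ(n)(n^{−σ} − κn^{−σ₁}) P(arg χ(n))` over `(n,k) = 1`, with
non-negative terms. [cite: McCurley1984ZFR, §4 (27)] -/
theorem rosser_positivity (χ : DirichletCharacter ℂ k) {σ : ℝ} (hσ : 1 < σ) :
    0 ≤ rsA0 * fdiff (χ ^ 0) σ + rsA1 * fdiff (χ ^ 1) σ + rsA2 * fdiff (χ ^ 2) σ
      + rsA3 * fdiff (χ ^ 3) σ + rsA4 * fdiff (χ ^ 4) σ := by
  have hσ₁ : 1 < sigmaOne σ := one_lt_sigmaOne hσ.le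
  have hσσ₁ : σ ≤ sigmaOne σ := (lt_sigmaOne (show (0 : ℝ) < σ by linarith)).le
  have S : ∀ m : ℕ, HasSum (fun n : ℕ ↦ rsCoeff m * ((Λ n : ℝ) * ((χ ^ m) (n : ZMod k)).re / (n : ℝ) ^ σ)
      - rsCoeff m * (kappa * ((Λ n : ℝ) * ((χ ^ m) (n : ZMod k)).re / (n : ℝ) ^ sigmaOne σ)))
      (rsCoeff m * fdiff (χ ^ m) σ) := by
    intro m
    have h := ((hasSum_re_twist (χ ^ m) hσ).mul_left (rsCoeff m)).sub
      (((hasSum_re_twist (χ ^ m) hσ₁).mul_left kappa).mul_left (rsCoeff m))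
    unfold fdiff
    rw [mul_sub]
    exact h
  have hS := (((S 0).add (S 1)).add (S 2)).add ((S 3).add (S 4))
  simp only [rsCoeff] at hS
  have e : rsA0 * fdiff (χ ^ 0) σ + rsA1 * fdiff (χ ^ 1) σ + rsA2 * fdiff (χ ^ 2) σ
      + rsA3 * fdiff (χ ^ 3) σ + rsA4 * fdiff (χ ^ 4) σ =
      rsA0 * fdiff (χ ^ 0) σ + rsA1 * fdiff (χ ^ 1) σ + rsA2 * fdiff (χ ^ 2) σ
      + (rsA3 * fdiff (χ ^ 3) σ + rsA4 * fdiff (χ ^ 4) σ) := by ring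
  rw [e]
  refine hS.nonneg fun n ↦ ?_
  set a := (Λ n : ℝ) with hadef
  set u := (n : ℝ) ^ σ with hudef
  set v := (n : ℝ) ^ sigmaOne σ with hvdef
  have ha : 0 ≤ a := vonMangoldt_nonneg
  have hw : 0 ≤ 1 / u - kappa * (1 / v) := by
    rcases Nat.eq_zero_or_pos n with hn | hn
    · have hu0 : u = 0 := by rw [hudef, hn, Nat.cast_zero, Real.zero_rpow (by linarith)]
      have hv0 : v = 0 := by rw [hvdef, hn, Nat.cast_zero, Real.zero_rpow (by linarith)]
      simp [hu0, hv0]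
    · have hn1 : (1 : ℝ) ≤ n := by exact_mod_cast hn
      have hupos : 0 < u := Real.rpow_pos_of_pos (by linarith) _
      have huv : u ≤ v := Real.rpow_le_rpow_of_exponent_le hn1 hσσ₁
      have h1 : 1 / v ≤ 1 / u := one_div_le_one_div_of_le hupos huv
      have h2 : 0 ≤ 1 / v := by positivity
      nlinarith [kappa_lt_one, kappa_pos]
  have hP := rosserSum_char_nonneg χ (n : ZMod k)
  set x0 := ((χ ^ 0) (n : ZMod k)).re
  set x1 := ((χ ^ 1) (n : ZMod k)).re
  set x2 := ((χ ^ 2) (n : ZMod k)).re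
  set x3 := ((χ ^ 3) (n : ZMod k)).re
  set x4 := ((χ ^ 4) (n : ZMod k)).re
  have key : 0 ≤ a * (1 / u - kappa * (1 / v)) *
      (rsA0 * x0 + rsA1 * x1 + rsA2 * x2 + rsA3 * x3 + rsA4 * x4) :=
    mul_nonneg (mul_nonneg ha hw) hP
  have e2 : a * (1 / u - kappa * (1 / v)) * (rsA0 * x0 + rsA1 * x1 + rsA2 * x2 + rsA3 * x3 + rsA4 * x4)
      = (rsA0 * (a * x0 / u) - rsA0 * (kappa * (a * x0 / v)))
        + (rsA1 * (a * x1 / u) - rsA1 * (kappa * (a * x1 / v)))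
        + (rsA2 * (a * x2 / u) - rsA2 * (kappa * (a * x2 / v)))
        + ((rsA3 * (a * x3 / u) - rsA3 * (kappa * (a * x3 / v)))
          + (rsA4 * (a * x4 / u) - rsA4 * (kappa * (a * x4 / v)))) := by ring
  linarith [key, e2]

end Positivity


/-! ## The Euler-factor corrections for induced characters (complex values) -/

section EulerC

open DirichletCharacter

/-- The logarithmic derivative of one Euler factor `1 − w p^{−s}` at a real point `t`:
`e(w, p, t) = w · log p · p^{−t}/(1 − w p^{−t})` (`w = ψ(p)`, `|w| ≤ 1`).
[cite: McCurley1984ZFR, Lemma 6 (15)–(16)] -/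
def eulerCorrC (w : ℂ) (p : ℕ) (t : ℝ) : ℂ :=
  w * (Real.log p : ℂ) * (((p : ℝ) ^ (-t) : ℝ) : ℂ) / (1 - w * (((p : ℝ) ^ (-t) : ℝ) : ℂ))

/-- `0 < p^{−t} < 1` for `p ≥ 2`, `t > 0`. [folklore] -/
private theorem rpow_neg_mem {p : ℕ} (hp : 2 ≤ p) {t : ℝ} (ht : 0 < t) :
    0 < (p : ℝ) ^ (-t) ∧ (p : ℝ) ^ (-t) < 1 := by
  have hp1 : (1 : ℝ) < p := by exact_mod_cast hp
  exact ⟨Real.rpow_pos_of_pos (by linarith) _, Real.rpow_lt_one_of_one_lt_of_neg hp1 (by linarith)⟩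

/-- `‖w p^{−t}‖ < 1` and `1 − w p^{−t} ≠ 0` for `‖w‖ ≤ 1`, `p ≥ 2`, `t > 0`. [folklore] -/
private theorem one_sub_ne_zero {p : ℕ} (hp : 2 ≤ p) {w : ℂ} (hw : ‖w‖ ≤ 1) {t : ℝ} (ht : 0 < t) :
    ‖w * (((p : ℝ) ^ (-t) : ℝ) : ℂ)‖ < 1 ∧ (1 : ℂ) - w * (((p : ℝ) ^ (-t) : ℝ) : ℂ) ≠ 0 := by
  obtain ⟨hu0, hu1⟩ := rpow_neg_mem hp ht
  have h1 : ‖w * (((p : ℝ) ^ (-t) : ℝ) : ℂ)‖ < 1 := by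
    rw [norm_mul, Complex.norm_real, Real.norm_eq_abs, abs_of_pos hu0]
    calc ‖w‖ * (p : ℝ) ^ (-t) ≤ 1 * (p : ℝ) ^ (-t) := mul_le_mul_of_nonneg_right hw hu0.le
      _ < 1 := by linarith
  refine ⟨h1, fun h ↦ ?_⟩
  have : w * (((p : ℝ) ^ (-t) : ℝ) : ℂ) = 1 := (sub_eq_zero.1 h).symm
  rw [this, norm_one] at h1
  exact lt_irrefl _ h1

/-- **The log-derivative of an Euler factor, complex form.** For `p ≥ 2`, `‖w‖ ≤ 1`, real `t > 0`:
`1 − w p^{−t} ≠ 0`, `s ↦ 1 − w p^{−s}` is differentiable at `t`, and its logarithmic derivative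
there is `e(w, p, t)`. [cite: McCurley1984ZFR, Lemma 6 (15)] -/
theorem logDeriv_eulerFactorC {p : ℕ} (hp : 2 ≤ p) {w : ℂ} (hw : ‖w‖ ≤ 1) {t : ℝ} (ht : 0 < t) :
    (1 - w * (p : ℂ) ^ (-(t : ℂ)) ≠ 0) ∧
    DifferentiableAt ℂ (fun s : ℂ ↦ 1 - w * (p : ℂ) ^ (-s)) t ∧
    logDeriv (fun s : ℂ ↦ 1 - w * (p : ℂ) ^ (-s)) t = eulerCorrC w p t := by
  have hp0 : (p : ℂ) ≠ 0 := by exact_mod_cast (show p ≠ 0 by omega)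
  have hpow : (p : ℂ) ^ (-(t : ℂ)) = (((p : ℝ) ^ (-t) : ℝ) : ℂ) := by
    rw [Complex.ofReal_cpow (Nat.cast_nonneg p), Complex.ofReal_natCast, Complex.ofReal_neg]
  obtain ⟨-, hne⟩ := one_sub_ne_zero hp hw ht
  have hneC : (1 : ℂ) - w * (p : ℂ) ^ (-(t : ℂ)) ≠ 0 := by rwa [hpow]
  have hd : HasDerivAt (fun s : ℂ ↦ 1 - w * (p : ℂ) ^ (-s))
      (-(w * ((p : ℂ) ^ (-(t : ℂ)) * Complex.log p * (-1)))) t := by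
    have h1 : HasDerivAt (fun s : ℂ ↦ -s) (-1) (t : ℂ) := (hasDerivAt_id (t : ℂ)).neg
    have h2 := h1.const_cpow (c := (p : ℂ)) (Or.inl hp0)
    exact (h2.const_mul w).const_sub 1
  refine ⟨hneC, hd.differentiableAt, ?_⟩
  rw [logDeriv_apply, hd.deriv]
  unfold eulerCorrC
  have hlog : Complex.log (p : ℂ) = ((Real.log p : ℝ) : ℂ) := by
    rw [← Complex.ofReal_natCast, Complex.ofReal_log (Nat.cast_nonneg p)]
  rw [hpow, hlog]
  ring

/-- **Size of the correction**: `‖e(w,p,t)‖ ≤ log p · u/(1 − u)`, `u = p^{−t}`, for `‖w‖ ≤ 1`.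
[cite: McCurley1984ZFR, Lemma 6 (16)] -/
theorem norm_eulerCorrC_le {p : ℕ} (hp : 2 ≤ p) {w : ℂ} (hw : ‖w‖ ≤ 1) {t : ℝ} (ht : 0 < t) :
    ‖eulerCorrC w p t‖ ≤ Real.log p * ((p : ℝ) ^ (-t) / (1 - (p : ℝ) ^ (-t))) := by
  obtain ⟨hu0, hu1⟩ := rpow_neg_mem hp ht
  obtain ⟨hlt, hne⟩ := one_sub_ne_zero hp hw ht
  have hp1 : (1 : ℝ) ≤ p := by exact_mod_cast (show 1 ≤ p by omega)
  have hlogp : 0 ≤ Real.log p := Real.log_nonneg hp1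
  set u : ℝ := (p : ℝ) ^ (-t) with hudef
  have hwu : ‖w * (u : ℂ)‖ ≤ u := by
    rw [norm_mul, Complex.norm_real, Real.norm_eq_abs, abs_of_pos hu0]
    calc ‖w‖ * u ≤ 1 * u := mul_le_mul_of_nonneg_right hw hu0.le
      _ = u := one_mul u
  have hden : 1 - u ≤ ‖(1 : ℂ) - w * (u : ℂ)‖ := by
    have := norm_sub_norm_le (1 : ℂ) (w * (u : ℂ))
    rw [norm_one] at this
    linarith
  unfold eulerCorrC
  rw [norm_div, norm_mul, norm_mul, Complex.norm_real, Real.norm_eq_abs, abs_of_nonneg hlogp]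
  have hnum : ‖w‖ * Real.log p * ‖((u : ℝ) : ℂ)‖ ≤ Real.log p * u := by
    rw [Complex.norm_real, Real.norm_eq_abs, abs_of_pos hu0]
    calc ‖w‖ * Real.log p * u ≤ 1 * Real.log p * u := by gcongr
      _ = Real.log p * u := by ring
  have hpos : 0 < ‖(1 : ℂ) - w * (u : ℂ)‖ := norm_pos_iff.2 hne
  calc ‖w‖ * Real.log p * ‖((u : ℝ) : ℂ)‖ / ‖(1 : ℂ) - w * (u : ℂ)‖
      ≤ Real.log p * u / ‖(1 : ℂ) - w * (u : ℂ)‖ := div_le_div_of_nonneg_right hnum hpos.le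
    _ ≤ Real.log p * u / (1 - u) := div_le_div_of_nonneg_left (by positivity) (by linarith) hden
    _ = Real.log p * (u / (1 - u)) := by ring

/-- The correction for the value `w = 1` is the real number `log p · u/(1−u)`.
[cite: McCurley1984ZFR, §2 (definition of `s(k)`)] -/
theorem eulerCorrC_one (p : ℕ) (t : ℝ) :
    eulerCorrC 1 p t = ((Real.log p * ((p : ℝ) ^ (-t) / (1 - (p : ℝ) ^ (-t))) : ℝ) : ℂ) := by
  unfold eulerCorrC
  push_cast
  ring

/-- The correction for the value `w = 0` vanishes. [folklore] -/
private theorem eulerCorrC_zero (p : ℕ) (t : ℝ) : eulerCorrC 0 p t = 0 := by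
  simp [eulerCorrC]

variable {d N : ℕ} [NeZero d] [NeZero N]

/-- **The log-derivative of an induced character's `L`-function at a real point `t > 1`.** For
`ψ` mod `d ∣ N` (any `ψ`, the trivial character included):
`Re(−L'/L(t, ψ mod N)) = Re(−L'/L(t, ψ)) − Σ_{p ∣ N} Re e(ψ(p), p, t)`
(`L(s, ψ mod N) = L(s, ψ) ∏_{p∣N}(1 − ψ(p)p^{−s})` for `s ≠ 1`, Mathlib's `LFunction_changeLevel`).
[cite: McCurley1984ZFR, Lemma 6 (15)–(16)] -/
theorem re_negLogDeriv_changeLevel (ψ : DirichletCharacter ℂ d) (hd : d ∣ N) {t : ℝ} (ht : 1 < t) :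
    (-(deriv (changeLevel hd ψ).LFunction t / (changeLevel hd ψ).LFunction t)).re =
      (-(deriv ψ.LFunction t / ψ.LFunction t)).re
        - ∑ p ∈ N.primeFactors, (eulerCorrC (ψ p) p t).re := by
  have ht0 : 0 < t := by linarith
  have ht1 : (t : ℂ) ≠ 1 := by
    intro h; have := congrArg Complex.re h; simp at this; linarith
  set g : ℂ → ℂ := fun s ↦ ψ.LFunction s * ∏ p ∈ N.primeFactors, (1 - ψ p * (p : ℂ) ^ (-s))
    with hgdef
  have hEq : (changeLevel hd ψ).LFunction =ᶠ[nhds (t : ℂ)] g := by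
    have hopen : IsOpen ({1}ᶜ : Set ℂ) := isOpen_compl_singleton
    filter_upwards [hopen.mem_nhds (show (t : ℂ) ∈ ({1}ᶜ : Set ℂ) from ht1)] with s hs
    exact LFunction_changeLevel hd ψ (Or.inr hs)
  have hval : (changeLevel hd ψ).LFunction t = g t := hEq.eq_of_nhds
  have hder : deriv (changeLevel hd ψ).LFunction t = deriv g t := hEq.deriv_eq
  have ht1' : (1 : ℝ) ≤ ((t : ℂ)).re := by simp only [ofReal_re]; exact ht.le
  have hLt : ψ.LFunction t ≠ 0 := LFunction_ne_zero_of_one_le_re ψ (Or.inr ht1) ht1'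
  have hw : ∀ p : ℕ, ‖ψ (p : ZMod d)‖ ≤ 1 := fun p ↦ ψ.norm_le_one _
  have hfac : ∀ p ∈ N.primeFactors,
      (1 - ψ p * (p : ℂ) ^ (-(t : ℂ)) ≠ 0) ∧
      DifferentiableAt ℂ (fun s : ℂ ↦ 1 - ψ p * (p : ℂ) ^ (-s)) t ∧
      logDeriv (fun s : ℂ ↦ 1 - ψ p * (p : ℂ) ^ (-s)) t = eulerCorrC (ψ p) p t :=
    fun p hp ↦ logDeriv_eulerFactorC (Nat.prime_of_mem_primeFactors hp).two_le (hw p) ht0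
  have hE : (∏ p ∈ N.primeFactors, (1 - ψ p * (p : ℂ) ^ (-(t : ℂ)))) ≠ 0 :=
    Finset.prod_ne_zero_iff.2 fun p hp ↦ (hfac p hp).1
  have hEd : DifferentiableAt ℂ
      (fun s : ℂ ↦ ∏ p ∈ N.primeFactors, (1 - ψ p * (p : ℂ) ^ (-s))) t :=
    DifferentiableAt.fun_finsetProd fun p hp ↦ (hfac p hp).2.1
  have hLd : DifferentiableAt ℂ ψ.LFunction t := differentiableAt_LFunction ψ t (Or.inl ht1)
  have h1 : logDeriv g t = logDeriv ψ.LFunction t + ∑ p ∈ N.primeFactors, eulerCorrC (ψ p) p t := by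
    rw [hgdef, logDeriv_mul (t : ℂ) hLt hE hLd hEd,
      logDeriv_prod (fun p hp ↦ (hfac p hp).1) (fun p hp ↦ (hfac p hp).2.1)]
    congr 1
    exact Finset.sum_congr rfl fun p hp ↦ (hfac p hp).2.2
  have h0 : logDeriv (changeLevel hd ψ).LFunction t = logDeriv g t := by
    rw [logDeriv_apply, logDeriv_apply, hval, hder]
  have h2 := congrArg Complex.re (h0.trans h1)
  rw [logDeriv_apply, logDeriv_apply, add_re, Complex.re_sum] at h2
  rw [neg_re, neg_re, h2]
  ring

/-- The same in `fdiff` form: `f_{ψ mod N}(σ) = f_ψ(σ) − Σ_{p∣N} [Re e(ψ(p),p,σ) − κ Re e(ψ(p),p,σ₁)]`.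
[cite: McCurley1984ZFR, Lemma 6 (16)] -/
theorem fdiff_changeLevel_eq (ψ : DirichletCharacter ℂ d) (hd : d ∣ N) {σ : ℝ} (hσ : 1 < σ) :
    fdiff (changeLevel hd ψ) σ = fdiff ψ σ
      - ∑ p ∈ N.primeFactors, ((eulerCorrC (ψ p) p σ).re
          - kappa * (eulerCorrC (ψ p) p (sigmaOne σ)).re) := by
  have hσ₁ : 1 < sigmaOne σ := one_lt_sigmaOne hσ.le
  unfold fdiff
  rw [re_negLogDeriv_changeLevel ψ hd hσ, re_negLogDeriv_changeLevel ψ hd hσ₁, Finset.sum_sub_distrib,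
    ← Finset.mul_sum]
  ring

/-- **The principal character.** `f_{χ₀ mod k}(σ) = f_ζ(σ) − s_k(σ)` with
`s_k(σ) = Σ_{p∣k} log p [u/(1−u) − κ u₁/(1−u₁)]`, `u = p^{−σ}`, `u₁ = p^{−σ₁}`.
[cite: McCurley1984ZFR, §2 (5) and Lemma 3] -/
theorem fdiff_one_eq (k : ℕ) [NeZero k] {σ : ℝ} (hσ : 1 < σ) :
    fdiff (1 : DirichletCharacter ℂ k) σ = fdiffZeta σ
      - ∑ p ∈ k.primeFactors, (Real.log p * ((p : ℝ) ^ (-σ) / (1 - (p : ℝ) ^ (-σ)))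
          - kappa * (Real.log p * ((p : ℝ) ^ (-sigmaOne σ) / (1 - (p : ℝ) ^ (-sigmaOne σ))))) := by
  have h := fdiff_changeLevel_eq (1 : DirichletCharacter ℂ 1) (one_dvd k) hσ
  rw [changeLevel_one] at h
  rw [h]
  have hζ : fdiff (1 : DirichletCharacter ℂ 1) σ = fdiffZeta σ := by
    unfold fdiff fdiffZeta
    rw [LFunction_modOne_eq]
  rw [hζ]
  congr 1
  refine Finset.sum_congr rfl fun p _ ↦ ?_
  rw [MulChar.one_apply (isUnit_of_subsingleton _), eulerCorrC_one, eulerCorrC_one, Complex.ofReal_re,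
    Complex.ofReal_re]

end EulerC


/-! ## Per-prime bookkeeping of the corrections ((36)–(37) of the source, our constants) -/

section PerPrime

/-- `U(p, t) = log p · p^{−t}/(1 − p^{−t}) = log p/(pᵗ − 1)` (the `w = 1` correction).
[cite: McCurley1984ZFR, §2 (`s(k)`, `T(k,k₁)`)] -/
def uCorr (p : ℕ) (t : ℝ) : ℝ :=
  Real.log p * ((p : ℝ) ^ (-t) / (1 - (p : ℝ) ^ (-t)))

/-- The differenced correction of a value `w`: `−[Re e(w,p,σ) − κ Re e(w,p,σ₁)]`.
[cite: McCurley1984ZFR, Lemma 6 (16)] -/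
def corrC (w : ℂ) (p : ℕ) (σ : ℝ) : ℝ :=
  -((eulerCorrC w p σ).re - kappa * (eulerCorrC w p (sigmaOne σ)).re)

/-- The per-prime penalty of one corrected index: `G(p,σ) = U(p,σ) + κ U(p,σ₁) − K log p`.
[cite: McCurley1984ZFR, §4 (36)] -/
def gPen (p : ℕ) (σ : ℝ) : ℝ :=
  uCorr p σ + kappa * uCorr p (sigmaOne σ) - bigK * Real.log p

/-- `a₂ + a₃ + a₄ = 17.43298784`. [cite: McCurley1984ZFR, §4 (36)] -/
def rsA234 : ℝ := rsA2 + rsA3 + rsA4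

/-- The per-prime total: `T(p,σ) = (a₂+a₃+a₄) max(G(p,σ),0) − a₀ [U(p,σ) − κ U(p,σ₁)]`.
[cite: McCurley1984ZFR, §4 (36)–(37)] -/
def tPen (p : ℕ) (σ : ℝ) : ℝ :=
  rsA234 * max (gPen p σ) 0 - rsA0 * (uCorr p σ - kappa * uCorr p (sigmaOne σ))

/-- `p^{−t}/(1 − p^{−t}) = 1/(pᵗ − 1)` (`p ≥ 2`, `t > 0`). [folklore] -/
private theorem rpow_neg_div_eq {p : ℕ} (hp : 2 ≤ p) {t : ℝ} (ht : 0 < t) :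
    (p : ℝ) ^ (-t) / (1 - (p : ℝ) ^ (-t)) = 1 / ((p : ℝ) ^ t - 1) := by
  have hp0 : (0 : ℝ) < p := by exact_mod_cast (show 0 < p by omega)
  have hp1 : (1 : ℝ) < p := by exact_mod_cast hp
  have hpt : 1 < (p : ℝ) ^ t := Real.one_lt_rpow hp1 ht
  rw [Real.rpow_neg hp0.le]
  field_simp

/-- `0 ≤ U(p,t)` (`p ≥ 2`, `t > 0`). [cite: McCurley1984ZFR, §2 (`s(k) > 0`)] -/
theorem uCorr_nonneg {p : ℕ} (hp : 2 ≤ p) {t : ℝ} (ht : 0 < t) : 0 ≤ uCorr p t := by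
  have hp1 : (1 : ℝ) < p := by exact_mod_cast hp
  have hpt : 1 < (p : ℝ) ^ t := Real.one_lt_rpow hp1 ht
  unfold uCorr
  rw [rpow_neg_div_eq hp ht]
  exact mul_nonneg (Real.log_nonneg hp1.le) (by positivity)

/-- `U(p,t') ≤ U(p,t)` for `t ≤ t'` (`p ≥ 2`, `t > 0`). [cite: McCurley1984ZFR, §2 (`s(k)`)] -/
theorem uCorr_anti {p : ℕ} (hp : 2 ≤ p) {t t' : ℝ} (ht : 0 < t) (htt : t ≤ t') :
    uCorr p t' ≤ uCorr p t := by
  have hp1 : (1 : ℝ) < p := by exact_mod_cast hp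
  have ht' : 0 < t' := lt_of_lt_of_le ht htt
  have hpt : 1 < (p : ℝ) ^ t := Real.one_lt_rpow hp1 ht
  have hmono : (p : ℝ) ^ t ≤ (p : ℝ) ^ t' := Real.rpow_le_rpow_of_exponent_le hp1.le htt
  unfold uCorr
  rw [rpow_neg_div_eq hp ht, rpow_neg_div_eq hp ht']
  refine mul_le_mul_of_nonneg_left ?_ (Real.log_nonneg hp1.le)
  exact one_div_le_one_div_of_le (by linarith) (by linarith)

/-- `U(p,t) ≤ log p/(p − 1)` for `t ≥ 1`. [cite: McCurley1984ZFR, §4 (32)] -/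
theorem uCorr_le_of_one_le {p : ℕ} (hp : 2 ≤ p) {t : ℝ} (ht : 1 ≤ t) :
    uCorr p t ≤ Real.log p / ((p : ℝ) - 1) := by
  have hp1 : (1 : ℝ) < p := by exact_mod_cast hp
  have h := uCorr_anti hp one_pos ht
  unfold uCorr at h ⊢
  rw [rpow_neg_div_eq hp one_pos, Real.rpow_one] at h
  calc _ ≤ Real.log p * (1 / ((p : ℝ) - 1)) := h
    _ = Real.log p / ((p : ℝ) - 1) := by ring

/-- `p^{3/2} = p √p`. [folklore] -/
private theorem rpow_three_halves {p : ℕ} (hp : 2 ≤ p) :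
    (p : ℝ) ^ ((3 : ℝ) / 2) = (p : ℝ) * Real.sqrt p := by
  have hp0 : (0 : ℝ) < p := by exact_mod_cast (show 0 < p by omega)
  rw [show ((3 : ℝ) / 2) = 1 + 1 / 2 by norm_num, Real.rpow_add hp0, Real.rpow_one,
    ← Real.sqrt_eq_rpow]

/-- `U(p, 3/2) = log p/(p√p − 1)`. [folklore] -/
private theorem uCorr_three_halves {p : ℕ} (hp : 2 ≤ p) :
    uCorr p ((3 : ℝ) / 2) = Real.log p / ((p : ℝ) * Real.sqrt p - 1) := by
  unfold uCorr
  rw [rpow_neg_div_eq hp (t := (3 : ℝ) / 2) (by norm_num), rpow_three_halves hp]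
  ring

/-- `U(p, σ₁) ≤ log p/(p√p − 1)` (`σ₁ ≥ 1.618 ≥ 3/2`). [cite: McCurley1984ZFR, §2 (`σ₁`)] -/
theorem uCorr_sigmaOne_le {p : ℕ} (hp : 2 ≤ p) {σ : ℝ} (hσ : 1 ≤ σ) :
    uCorr p (sigmaOne σ) ≤ Real.log p / ((p : ℝ) * Real.sqrt p - 1) := by
  have hσ₁ : (3 : ℝ) / 2 ≤ sigmaOne σ := by linarith [sigmaOne_gt_1618 hσ]
  have h := uCorr_anti hp (by norm_num : (0 : ℝ) < 3 / 2) hσ₁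
  rwa [uCorr_three_halves hp] at h

/-- **Per-value bound.** For `p` prime, `‖w‖ ≤ 1`, `σ > 1`:
`corr(w,p,σ) ≤ [w ≠ 0]·(U(p,σ) + κ U(p,σ₁))`. [cite: McCurley1984ZFR, Lemma 6 (16)] -/
theorem corrC_le {p : ℕ} (hp : 2 ≤ p) {w : ℂ} (hw : ‖w‖ ≤ 1) {σ : ℝ} (hσ : 1 < σ) :
    corrC w p σ ≤ (if w = 0 then 0 else uCorr p σ + kappa * uCorr p (sigmaOne σ)) := by
  by_cases h0 : w = 0
  · simp [corrC, h0, eulerCorrC_zero]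
  · rw [if_neg h0]
    have hσ₁ : 1 < sigmaOne σ := one_lt_sigmaOne hσ.le
    have h1 := norm_eulerCorrC_le hp hw (show 0 < σ by linarith)
    have h2 := norm_eulerCorrC_le hp hw (show 0 < sigmaOne σ by linarith)
    have r1 := Complex.abs_re_le_norm (eulerCorrC w p σ)
    have r2 := Complex.abs_re_le_norm (eulerCorrC w p (sigmaOne σ))
    unfold corrC uCorr
    have := abs_le.1 (r1.trans h1)
    have := abs_le.1 (r2.trans h2)
    nlinarith [kappa_pos, this.1, this.2]

/-- **One corrected index at one prime.** For `c ≥ 0`: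
`c·corr(w,p,σ) − K log p · c·[w ≠ 0] ≤ c · max(G(p,σ), 0)`. [cite: McCurley1984ZFR, §4 (36)] -/
theorem index_term_le {p : ℕ} (hp : 2 ≤ p) {w : ℂ} (hw : ‖w‖ ≤ 1) {σ : ℝ} (hσ : 1 < σ) {c : ℝ}
    (hc : 0 ≤ c) :
    c * corrC w p σ - bigK * (if w = 0 then 0 else Real.log p) * c ≤ c * max (gPen p σ) 0 := by
  have h := corrC_le hp hw hσ
  by_cases h0 : w = 0
  · rw [if_pos h0] at h; rw [if_pos h0]
    have : c * corrC w p σ ≤ 0 := by nlinarith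
    nlinarith [le_max_right (gPen p σ) 0]
  · rw [if_neg h0] at h; rw [if_neg h0]
    have hG : uCorr p σ + kappa * uCorr p (sigmaOne σ) - bigK * Real.log p ≤ max (gPen p σ) 0 :=
      le_max_left _ _
    nlinarith

/-- `1.41421 < √2 < 1.41422`. [folklore] -/
private theorem sqrt2_bounds : (1.41421 : ℝ) < Real.sqrt 2 ∧ Real.sqrt 2 < 1.41422 := by
  constructor
  · rw [show (1.41421 : ℝ) = Real.sqrt (1.41421 ^ 2) by rw [Real.sqrt_sq (by norm_num)]]
    exact Real.sqrt_lt_sqrt (by norm_num) (by norm_num)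
  · rw [show (1.41422 : ℝ) = Real.sqrt (1.41422 ^ 2) by rw [Real.sqrt_sq (by norm_num)]]
    exact Real.sqrt_lt_sqrt (by norm_num) (by norm_num)

/-- `1.732 < √3`. [folklore] -/
private theorem sqrt3_gt : (1.732 : ℝ) < Real.sqrt 3 := by
  rw [show (1.732 : ℝ) = Real.sqrt (1.732 ^ 2) by rw [Real.sqrt_sq (by norm_num)]]
  exact Real.sqrt_lt_sqrt (by norm_num) (by norm_num)

/-- `2.236 < √5`. [folklore] -/
private theorem sqrt5_gt' : (2.236 : ℝ) < Real.sqrt 5 := by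
  rw [show (2.236 : ℝ) = Real.sqrt (2.236 ^ 2) by rw [Real.sqrt_sq (by norm_num)]]
  exact Real.sqrt_lt_sqrt (by norm_num) (by norm_num)

/-- `log 3 ∈ [1.0986122886, 1.0986122887]` (Taylor bounds for `exp`; the proof of the tree's
`KadiriNumerics.log_3_bounds`, repeated here to keep the imports light). [folklore] -/
private theorem log_three_bounds : (1.0986122886 : ℝ) ≤ Real.log 3 ∧ Real.log 3 ≤ 1.0986122887 := by
  have hA : Real.exp 1.0986122886 ≤ 3 := by
    have hx0 : (0:ℝ) ≤ 0.27465307215 := by norm_num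
    have hx1 : (0.27465307215:ℝ) ≤ 1 := by norm_num
    have hu := Real.exp_bound' hx0 hx1 (n := 18) (by norm_num)
    simp only [Finset.sum_range_succ, Finset.sum_range_zero] at hu
    have e : Real.exp 1.0986122886 = Real.exp 0.27465307215 ^ 4 := by
      rw [← Real.exp_nat_mul]; norm_num
    rw [e]
    exact le_trans (pow_le_pow_left₀ (Real.exp_nonneg _) hu 4) (by norm_num [Nat.factorial])
  have hB : (3 : ℝ) ≤ Real.exp 1.0986122887 := by
    have hx0 : (0:ℝ) ≤ 0.274653072175 := by norm_num
    have hl := Real.sum_le_exp_of_nonneg hx0 18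
    simp only [Finset.sum_range_succ, Finset.sum_range_zero] at hl
    have e : Real.exp 1.0986122887 = Real.exp 0.274653072175 ^ 4 := by
      rw [← Real.exp_nat_mul]; norm_num
    rw [e]
    exact le_trans (by norm_num [Nat.factorial]) (pow_le_pow_left₀ (by norm_num [Nat.factorial]) hl 4)
  exact ⟨(Real.le_log_iff_exp_le (by norm_num)).2 hA, (Real.log_le_iff_le_exp (by norm_num)).2 hB⟩

/-- `log 5 ∈ [1.6094379124, 1.6094379125]` (Taylor bounds for `exp`; the proof of the tree's
`KadiriNumerics.log_5_bounds`). [folklore] -/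
private theorem log_five_bounds : (1.6094379124 : ℝ) ≤ Real.log 5 ∧ Real.log 5 ≤ 1.6094379125 := by
  have hA : Real.exp 1.6094379124 ≤ 5 := by
    have hx0 : (0:ℝ) ≤ 0.4023594781 := by norm_num
    have hx1 : (0.4023594781:ℝ) ≤ 1 := by norm_num
    have hu := Real.exp_bound' hx0 hx1 (n := 18) (by norm_num)
    simp only [Finset.sum_range_succ, Finset.sum_range_zero] at hu
    have e : Real.exp 1.6094379124 = Real.exp 0.4023594781 ^ 4 := by
      rw [← Real.exp_nat_mul]; norm_num
    rw [e]
    exact le_trans (pow_le_pow_left₀ (Real.exp_nonneg _) hu 4) (by norm_num [Nat.factorial])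
  have hB : (5 : ℝ) ≤ Real.exp 1.6094379125 := by
    have hx0 : (0:ℝ) ≤ 0.402359478125 := by norm_num
    have hl := Real.sum_le_exp_of_nonneg hx0 18
    simp only [Finset.sum_range_succ, Finset.sum_range_zero] at hl
    have e : Real.exp 1.6094379125 = Real.exp 0.402359478125 ^ 4 := by
      rw [← Real.exp_nat_mul]; norm_num
    rw [e]
    exact le_trans (by norm_num [Nat.factorial]) (pow_le_pow_left₀ (by norm_num [Nat.factorial]) hl 4)
  exact ⟨(Real.le_log_iff_exp_le (by norm_num)).2 hA, (Real.log_le_iff_le_exp (by norm_num)).2 hB⟩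

/-- `a₂ + a₃ + a₄ = 17.43298784` (unfolding). [cite: McCurley1984ZFR, §2 p. 10] -/
theorem rsA234_eq : rsA234 = 17.43298784 := by
  simp only [rsA234, rsA2, rsA3, rsA4]; norm_num

/-- **Large primes give no penalty**: `G(p,σ) ≤ 0` for primes `p ≥ 7`, `1 < σ`
(`U(p,σ₁) ≤ U(p,σ) ≤ log p/(p−1)` and `(1+κ)/6 < K`). [cite: McCurley1984ZFR, §4 (36)–(37)] -/
theorem gPen_nonpos_of_seven_le {p : ℕ} (hp7 : 7 ≤ p) {σ : ℝ} (hσ : 1 < σ) : gPen p σ ≤ 0 := by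
  have hp : 2 ≤ p := by omega
  have hp1 : (1 : ℝ) < p := by exact_mod_cast (show 1 < p by omega)
  have hp7' : (7 : ℝ) ≤ p := by exact_mod_cast hp7
  have hlogp : 0 ≤ Real.log p := Real.log_nonneg hp1.le
  have hU := uCorr_le_of_one_le hp hσ.le
  have hU1 : uCorr p (sigmaOne σ) ≤ uCorr p σ :=
    uCorr_anti hp (by linarith) (lt_sigmaOne (show (0:ℝ) < σ by linarith)).le
  have hU0 : 0 ≤ uCorr p σ := uCorr_nonneg hp (by linarith)
  have h6 : Real.log p / ((p : ℝ) - 1) ≤ Real.log p / 6 :=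
    div_le_div_of_nonneg_left hlogp (by norm_num) (by linarith)
  unfold gPen
  have hk := kappa_lt
  have hK := bigK_gt
  have h1 : kappa * uCorr p (sigmaOne σ) ≤ kappa * uCorr p σ :=
    mul_le_mul_of_nonneg_left hU1 kappa_pos.le
  have h2 : uCorr p σ ≤ Real.log p / 6 := hU.trans h6
  have h3 : (1 + kappa) * uCorr p σ ≤ (1 + kappa) * (Real.log p / 6) :=
    mul_le_mul_of_nonneg_left h2 (by linarith [kappa_pos])
  have h4 : (1 + kappa) * (Real.log p / 6) ≤ bigK * Real.log p := by
    have : (1 + kappa) / 6 ≤ bigK := by linarith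
    calc (1 + kappa) * (Real.log p / 6) = ((1 + kappa) / 6) * Real.log p := by ring
      _ ≤ bigK * Real.log p := mul_le_mul_of_nonneg_right this hlogp
  linarith

/-- Hence `T(p,σ) ≤ 0` for primes `p ≥ 7` (the `a₀`-term helps: `U(p,σ) ≥ κ U(p,σ₁)`).
[cite: McCurley1984ZFR, §4 (37)] -/
theorem tPen_nonpos_of_seven_le {p : ℕ} (hp7 : 7 ≤ p) {σ : ℝ} (hσ : 1 < σ) : tPen p σ ≤ 0 := by
  have hp : 2 ≤ p := by omega
  have hG := gPen_nonpos_of_seven_le hp7 hσ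
  have hU1 : uCorr p (sigmaOne σ) ≤ uCorr p σ :=
    uCorr_anti hp (by linarith) (lt_sigmaOne (show (0:ℝ) < σ by linarith)).le
  have hU0 : 0 ≤ uCorr p (sigmaOne σ) := uCorr_nonneg hp (by linarith [one_lt_sigmaOne hσ.le])
  unfold tPen
  rw [max_eq_right hG, rsA234_eq]
  simp only [rsA0]
  nlinarith [kappa_lt_one, kappa_pos]

/-- The help term is non-negative: `0 ≤ U(p,σ) − κ U(p,σ₁)`. [cite: McCurley1984ZFR, §2 (`s(k) > 0`)] -/
theorem help_nonneg {p : ℕ} (hp : 2 ≤ p) {σ : ℝ} (hσ : 1 < σ) :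
    0 ≤ uCorr p σ - kappa * uCorr p (sigmaOne σ) := by
  have hU1 : uCorr p (sigmaOne σ) ≤ uCorr p σ :=
    uCorr_anti hp (by linarith) (lt_sigmaOne (show (0:ℝ) < σ by linarith)).le
  have hU0 : 0 ≤ uCorr p (sigmaOne σ) := uCorr_nonneg hp (by linarith [one_lt_sigmaOne hσ.le])
  nlinarith [kappa_lt_one, kappa_pos]

/-- **`p = 2`**: `T(2,σ) ≤ 9.36` for `1 < σ ≤ 1.3` (`U(2,σ) ≤ log 2`, `U(2,σ₁) ≤ log 2/(2√2−1)`,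
and the help `U(2,σ) ≥ U(2, 3/2) = log 2/(2√2 − 1)`). [cite: McCurley1984ZFR, §4 (37)] -/
theorem tPen_two_le {σ : ℝ} (hσ : 1 < σ) (hσ' : σ ≤ 1.3) : tPen 2 σ ≤ 9.36 := by
  have h2 : 2 ≤ 2 := le_rfl
  have hU := uCorr_le_of_one_le h2 hσ.le
  have hU1 := uCorr_sigmaOne_le h2 hσ.le
  have hlow : uCorr 2 ((3 : ℝ) / 2) ≤ uCorr 2 σ := uCorr_anti h2 (by linarith) (by linarith)
  have hlow' : uCorr 2 ((3 : ℝ) / 2) = Real.log 2 / (2 * Real.sqrt 2 - 1) := by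
    rw [uCorr_three_halves h2]; push_cast; ring
  obtain ⟨hs1, hs2⟩ := sqrt2_bounds
  have hl2 := Real.log_two_lt_d9
  have hl2' := Real.log_two_gt_d9
  have hk1 := kappa_lt
  have hk2 := kappa_gt
  have hK := bigK_gt
  push_cast at hU hU1
  have hden : (1.82842 : ℝ) < 2 * Real.sqrt 2 - 1 := by linarith
  have hA : Real.log 2 / (2 * Real.sqrt 2 - 1) ≤ 0.6931471808 / 1.82842 :=
    div_le_div₀ (by norm_num) hl2.le (by norm_num) hden.le
  have hB : 0.6931471803 / 1.82844 ≤ Real.log 2 / (2 * Real.sqrt 2 - 1) :=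
    div_le_div₀ (by linarith) hl2'.le (by linarith) (by linarith)
  have hU2 : uCorr 2 σ ≤ Real.log 2 := by
    calc uCorr 2 σ ≤ Real.log 2 / ((2 : ℝ) - 1) := hU
      _ = Real.log 2 := by norm_num
  have hG : max (gPen 2 σ) 0 ≤ 0.6931471808 + 0.44723 * (0.6931471808 / 1.82842) - 0.276385 * 0.6931471803 := by
    refine max_le ?_ (by norm_num)
    unfold gPen
    have : kappa * uCorr 2 (sigmaOne σ) ≤ 0.44723 * (0.6931471808 / 1.82842) := by
      calc kappa * uCorr 2 (sigmaOne σ) ≤ kappa * (0.6931471808 / 1.82842) :=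
            mul_le_mul_of_nonneg_left (hU1.trans hA) kappa_pos.le
        _ ≤ 0.44723 * (0.6931471808 / 1.82842) :=
            mul_le_mul_of_nonneg_right hk1.le (by norm_num)
    nlinarith
  have hhelp : 0.6931471803 / 1.82844 - 0.44723 * (0.6931471808 / 1.82842) ≤
      uCorr 2 σ - kappa * uCorr 2 (sigmaOne σ) := by
    have : kappa * uCorr 2 (sigmaOne σ) ≤ 0.44723 * (0.6931471808 / 1.82842) := by
      calc kappa * uCorr 2 (sigmaOne σ) ≤ kappa * (0.6931471808 / 1.82842) :=
            mul_le_mul_of_nonneg_left (hU1.trans hA) kappa_pos.le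
        _ ≤ 0.44723 * (0.6931471808 / 1.82842) :=
            mul_le_mul_of_nonneg_right hk1.le (by norm_num)
    linarith [hlow, hlow'.symm ▸ hB]
  unfold tPen
  rw [rsA234_eq]
  simp only [rsA0]
  nlinarith [hG, hhelp, le_max_right (gPen 2 σ) 0]

/-- **`p = 3`**: `T(3,σ) ≤ 6.33` for `1 < σ` (help dropped; `U(3,σ) ≤ log 3/2`,
`U(3,σ₁) ≤ log 3/(3√3 − 1)`). [cite: McCurley1984ZFR, §4 (37)] -/
theorem tPen_three_le {σ : ℝ} (hσ : 1 < σ) : tPen 3 σ ≤ 6.33 := by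
  have h3 : 2 ≤ 3 := by norm_num
  have hU := uCorr_le_of_one_le h3 hσ.le
  have hU1 := uCorr_sigmaOne_le h3 hσ.le
  have hs3 := sqrt3_gt
  have hl3 := log_three_bounds
  obtain ⟨hl3a, hl3b⟩ := hl3
  have hl3pos : 0 < Real.log 3 := Real.log_pos (by norm_num)
  have hk1 := kappa_lt
  have hK := bigK_gt
  push_cast at hU hU1
  have hden : (4.196 : ℝ) < 3 * Real.sqrt 3 - 1 := by linarith
  have hA : Real.log 3 / (3 * Real.sqrt 3 - 1) ≤ 1.0986122887 / 4.196 :=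
    div_le_div₀ (by norm_num) hl3b (by norm_num) hden.le
  have hU3 : uCorr 3 σ ≤ 1.0986122887 / 2 := by
    calc uCorr 3 σ ≤ Real.log 3 / ((3 : ℝ) - 1) := hU
      _ ≤ 1.0986122887 / 2 := by rw [show ((3 : ℝ) - 1) = 2 by norm_num]; linarith [hl3b]
  have hG : max (gPen 3 σ) 0 ≤ 1.0986122887 / 2 + 0.44723 * (1.0986122887 / 4.196) - 0.276385 * 1.0986122886 := by
    refine max_le ?_ ?_
    · unfold gPen
      have : kappa * uCorr 3 (sigmaOne σ) ≤ 0.44723 * (1.0986122887 / 4.196) := by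
        calc kappa * uCorr 3 (sigmaOne σ) ≤ kappa * (1.0986122887 / 4.196) :=
              mul_le_mul_of_nonneg_left (hU1.trans hA) kappa_pos.le
          _ ≤ 0.44723 * (1.0986122887 / 4.196) := mul_le_mul_of_nonneg_right hk1.le (by norm_num)
      nlinarith
    · nlinarith
  have hh := help_nonneg h3 hσ
  unfold tPen
  rw [rsA234_eq]
  simp only [rsA0]
  nlinarith [hG, hh]

/-- **`p = 5`**: `T(5,σ) ≤ 0.5` for `1 < σ` (help dropped; `U(5,σ) ≤ log 5/4`,
`U(5,σ₁) ≤ log 5/(5√5 − 1)`). [cite: McCurley1984ZFR, §4 (37)] -/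
theorem tPen_five_le {σ : ℝ} (hσ : 1 < σ) : tPen 5 σ ≤ 0.5 := by
  have h5 : 2 ≤ 5 := by norm_num
  have hU := uCorr_le_of_one_le h5 hσ.le
  have hU1 := uCorr_sigmaOne_le h5 hσ.le
  have hs5 := sqrt5_gt'
  have hl5 := log_five_bounds
  obtain ⟨hl5a, hl5b⟩ := hl5
  have hl5pos : 0 < Real.log 5 := Real.log_pos (by norm_num)
  have hk1 := kappa_lt
  have hK := bigK_gt
  push_cast at hU hU1
  have hden : (10.18 : ℝ) < 5 * Real.sqrt 5 - 1 := by linarith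
  have hA : Real.log 5 / (5 * Real.sqrt 5 - 1) ≤ 1.6094379125 / 10.18 :=
    div_le_div₀ (by norm_num) hl5b (by norm_num) hden.le
  have hU5 : uCorr 5 σ ≤ Real.log 5 / 4 := by
    calc uCorr 5 σ ≤ Real.log 5 / ((5 : ℝ) - 1) := hU
      _ = Real.log 5 / 4 := by norm_num
  have hG : max (gPen 5 σ) 0 ≤ 1.6094379125 / 4 + 0.44723 * (1.6094379125 / 10.18) - 0.276385 * 1.6094379124 := by
    refine max_le ?_ ?_
    · unfold gPen
      have : kappa * uCorr 5 (sigmaOne σ) ≤ 0.44723 * (1.6094379125 / 10.18) := by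
        calc kappa * uCorr 5 (sigmaOne σ) ≤ kappa * (1.6094379125 / 10.18) :=
              mul_le_mul_of_nonneg_left (hU1.trans hA) kappa_pos.le
          _ ≤ 0.44723 * (1.6094379125 / 10.18) := mul_le_mul_of_nonneg_right hk1.le (by norm_num)
      nlinarith
    · nlinarith
  have hh := help_nonneg h5 hσ
  unfold tPen
  rw [rsA234_eq]
  simp only [rsA0]
  nlinarith [hG, hh]

/-- **The total correction**: for every modulus `k` and `1 < σ ≤ 1.3`,
`Σ_{p ∣ k} T(p,σ) ≤ 16.19` (only `p = 2, 3, 5` can contribute positively).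
[cite: McCurley1984ZFR, §4 (37)] -/
theorem sum_tPen_le (k : ℕ) {σ : ℝ} (hσ : 1 < σ) (hσ' : σ ≤ 1.3) :
    ∑ p ∈ k.primeFactors, tPen p σ ≤ 16.19 := by
  classical
  set b : ℕ → ℝ := fun p ↦ if p = 2 then 9.36 else if p = 3 then 6.33 else if p = 5 then 0.5 else 0
    with hbdef
  have hb0 : ∀ p, 0 ≤ b p := by
    intro p; simp only [hbdef]; split_ifs <;> norm_num
  have hle : ∀ p ∈ k.primeFactors, tPen p σ ≤ b p := by
    intro p hp
    have hpP := Nat.prime_of_mem_primeFactors hp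
    simp only [hbdef]
    by_cases h2 : p = 2
    · subst h2; simp; exact tPen_two_le hσ hσ'
    by_cases h3 : p = 3
    · subst h3; simp; exact tPen_three_le hσ
    by_cases h5 : p = 5
    · subst h5; simp; exact tPen_five_le hσ
    have h7 : 7 ≤ p := by
      have h2' := hpP.two_le
      by_contra hlt
      have hlt' : p < 7 := not_le.1 hlt
      interval_cases p
      all_goals first | omega | exact absurd hpP (by decide)
    rw [if_neg h2, if_neg h3, if_neg h5]
    exact tPen_nonpos_of_seven_le h7 hσ
  have hsub : ∑ p ∈ k.primeFactors, b p ≤ ∑ p ∈ ({2, 3, 5} : Finset ℕ), b p := by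
    have hsplit : ∑ p ∈ k.primeFactors, b p =
        ∑ p ∈ k.primeFactors.filter (fun p ↦ p ∈ ({2, 3, 5} : Finset ℕ)), b p := by
      rw [Finset.sum_filter]
      refine Finset.sum_congr rfl fun p _ ↦ ?_
      by_cases h : p ∈ ({2, 3, 5} : Finset ℕ)
      · rw [if_pos h]
      · rw [if_neg h]
        simp only [Finset.mem_insert, Finset.mem_singleton, not_or] at h
        simp [hbdef, h.1, h.2.1, h.2.2]
    rw [hsplit]
    exact Finset.sum_le_sum_of_subset_of_nonneg (fun p hp ↦ (Finset.mem_filter.1 hp).2)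
      fun p _ _ ↦ hb0 p
  have hval : ∑ p ∈ ({2, 3, 5} : Finset ℕ), b p = 16.19 := by
    simp [hbdef]; norm_num
  calc ∑ p ∈ k.primeFactors, tPen p σ ≤ ∑ p ∈ k.primeFactors, b p := Finset.sum_le_sum hle
    _ ≤ 16.19 := by rw [← hval]; exact hsub

end PerPrime


/-! ## The three kinds of indices: principal, zero-carrying, generic induced -/

section Indices

open DirichletCharacter

variable {k : ℕ} [NeZero k]

/-- `fdiff` in `logDeriv` form. [folklore] -/
private theorem fdiff_eq_logDeriv₃ (χ : DirichletCharacter ℂ k) (σ : ℝ) :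
    fdiff χ σ = (-logDeriv χ.LFunction σ).re - kappa * (-logDeriv χ.LFunction (sigmaOne σ)).re := by
  simp only [fdiff, logDeriv_apply]

/-- **Principal index**: `f_{χ₀ mod k}(σ) = f_ζ(σ) − Σ_{p∣k} [U(p,σ) − κ U(p,σ₁)]`.
[cite: McCurley1984ZFR, §2 (5), Lemma 3] -/
theorem fdiff_principal_eq {σ : ℝ} (hσ : 1 < σ) :
    fdiff (1 : DirichletCharacter ℂ k) σ =
      fdiffZeta σ - ∑ p ∈ k.primeFactors, (uCorr p σ - kappa * uCorr p (sigmaOne σ)) := by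
  rw [fdiff_one_eq k hσ]
  simp only [uCorr]

/-- **Principal index, bounded**: `f_{χ₀ mod k}(σ) ≤ 1/(σ−1) − 0.325 − Σ_{p∣k} help_p` for
`1 < σ ≤ 1.3`. [cite: McCurley1984ZFR, Lemma 3] -/
theorem fdiff_principal_le {σ : ℝ} (hσ : 1 < σ) (hσ' : σ ≤ 1.3) :
    fdiff (1 : DirichletCharacter ℂ k) σ ≤
      1 / (σ - 1) - 0.325 - ∑ p ∈ k.primeFactors, (uCorr p σ - kappa * uCorr p (sigmaOne σ)) := by
  rw [fdiff_principal_eq hσ]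
  have hZ := zetaTerm_le hσ hσ'
  unfold fdiffZeta
  linarith

/-- **Zero-carrying index**: for `ψ` primitive mod `k`, `ψ ≠ 1`, with a real zero
`β ∈ (0, 1]∖{½}`, and `1 < σ ≤ 1.3`: `f_ψ(σ) ≤ K log k − 0.44 − 1/(σ − β)`.
[cite: McCurley1984ZFR, Lemmas 5, 10 and §4 (29)] -/
theorem fdiff_zero_le (ψ : DirichletCharacter ℂ k) (hψ : ψ.IsPrimitive) (hψ1 : ψ ≠ 1) {β : ℝ}
    (hβ0 : 0 < β) (hβh : β ≠ 1 / 2) (hβ1 : β ≤ 1) (hz : ψ.LFunction β = 0) {σ : ℝ} (hσ : 1 < σ)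
    (hσ' : σ ≤ 1.3) :
    fdiff ψ σ ≤ bigK * Real.log k - 0.44 - 1 / (σ - β) := by
  have h := DirichletTheta.stechkinDiff_logDeriv_le_of_realZero hψ hψ1 hβ0 hβh hz hσ
  rw [← fdiff_eq_logDeriv₃] at h
  have hG := gammaTerm_le ψ hσ hσ'
  have hP := inv_sub_le_stechkinPair hσ.le hβ0 hβ1
  linarith

/-- **Generic induced index**: for any `ψ ≠ 1` mod `k` and `1 < σ ≤ 1.3`:
`f_ψ(σ) ≤ K log k − 0.44 + Σ_{p∣k} max(G(p,σ), 0)` (pass to the primitive character `ψ₁` mod `d`: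
`f_{ψ₁} ≤ K log d − 0.44`, each prime `p ∣ k` with `ψ₁(p) ≠ 0` costs at most
`U(p,σ) + κU(p,σ₁)` and these primes multiply to a divisor of `k/d`).
[cite: McCurley1984ZFR, Lemma 6 and §4 (36)] -/
theorem fdiff_induced_le (ψ : DirichletCharacter ℂ k) (hψ1 : ψ ≠ 1) {σ : ℝ} (hσ : 1 < σ)
    (hσ' : σ ≤ 1.3) :
    fdiff ψ σ ≤ bigK * Real.log k - 0.44 + ∑ p ∈ k.primeFactors, max (gPen p σ) 0 := by
  classical
  haveI : NeZero ψ.conductor := ⟨conductor_ne_zero ψ⟩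
  set d := ψ.conductor with hddef
  set ψ₁ := ψ.primitiveCharacter with hψ₁def
  have hind : changeLevel ψ.conductor_dvd_level ψ₁ = ψ := changeLevel_primitiveCharacter ψ
  have hψ₁1 : ψ₁ ≠ 1 := by
    intro h; apply hψ1; rw [← hind, h]; exact changeLevel_one _
  have hψ₁p : ψ₁.IsPrimitive := primitiveCharacter_isPrimitive ψ
  -- the primitive character
  have hprim : fdiff ψ₁ σ ≤ bigK * Real.log d - 0.44 := by
    have h := DirichletTheta.stechkinDiff_logDeriv_le hψ₁p hψ₁1 hσ
    rw [← fdiff_eq_logDeriv₃] at h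
    have hG := gammaTerm_le ψ₁ hσ hσ'
    linarith
  -- the Euler corrections
  have hrel : fdiff ψ σ = fdiff ψ₁ σ + ∑ p ∈ k.primeFactors, corrC (ψ₁ p) p σ := by
    have h := fdiff_changeLevel_eq ψ₁ ψ.conductor_dvd_level hσ
    rw [hind] at h
    rw [h]
    simp only [corrC, Finset.sum_neg_distrib]
    ring
  have hw : ∀ p : ℕ, ‖ψ₁ (p : ZMod d)‖ ≤ 1 := fun p ↦ ψ₁.norm_le_one _
  have hstep : ∑ p ∈ k.primeFactors, corrC (ψ₁ p) p σ ≤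
      ∑ p ∈ k.primeFactors, max (gPen p σ) 0 +
        bigK * ∑ p ∈ k.primeFactors, (if ψ₁ p = 0 then 0 else Real.log p) := by
    rw [Finset.mul_sum, ← Finset.sum_add_distrib]
    refine Finset.sum_le_sum fun p hp ↦ ?_
    have h := index_term_le (Nat.prime_of_mem_primeFactors hp).two_le (hw p) hσ zero_le_one
    simp only [one_mul, mul_one] at h
    linarith
  -- the primes `p ∣ k` with `ψ₁(p) ≠ 0` do not divide `d`; their product divides `k/d`
  have hlog : ∑ p ∈ k.primeFactors, (if ψ₁ p = 0 then (0 : ℝ) else Real.log p) ≤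
      Real.log k - Real.log d := by
    set S : Finset ℕ := k.primeFactors.filter (fun p : ℕ ↦ ¬ ψ₁ (p : ZMod d) = 0) with hSdef
    have hSum : ∑ p ∈ k.primeFactors, (if ψ₁ p = 0 then (0 : ℝ) else Real.log p) =
        ∑ p ∈ S, Real.log (p : ℝ) := by
      rw [hSdef, Finset.sum_filter]
      exact Finset.sum_congr rfl fun p _ ↦ by by_cases h : ψ₁ (p : ZMod d) = 0 <;> simp [h]
    rw [hSum]
    have hSprime : ∀ p ∈ S, p.Prime := fun p hp ↦
      Nat.prime_of_mem_primeFactors (Finset.mem_filter.1 hp).1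
    have hdk : d ∣ k := ψ.conductor_dvd_level
    have hSdvd : ∀ p ∈ S, p ∣ k / d := by
      intro p hp
      obtain ⟨hpk, hcp⟩ := Finset.mem_filter.1 hp
      have hpP := Nat.prime_of_mem_primeFactors hpk
      have hpdk : p ∣ k := Nat.dvd_of_mem_primeFactors hpk
      have hnd : ¬ p ∣ d := by
        intro hpd
        apply hcp
        have hnu : ¬IsUnit ((p : ZMod d)) := fun hu ↦ ((ZMod.isUnit_prime_iff_not_dvd hpP).1 hu) hpd
        exact MulChar.map_nonunit _ hnu
      have hk' : k = d * (k / d) := (Nat.mul_div_cancel' hdk).symm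
      rw [hk'] at hpdk
      exact ((Nat.Prime.dvd_mul hpP).1 hpdk).resolve_left hnd
    have hprod : ∏ p ∈ S, p ∣ k / d :=
      Finset.prod_primes_dvd (k / d) (fun p hp ↦ Nat.prime_iff.1 (hSprime p hp)) hSdvd
    have hkd : 0 < k / d := Nat.div_pos (Nat.le_of_dvd (Nat.pos_of_ne_zero (NeZero.ne k)) hdk)
      (Nat.pos_of_ne_zero (NeZero.ne d))
    have hle : (∏ p ∈ S, (p : ℝ)) ≤ (k : ℝ) / d := by
      have h := Nat.le_of_dvd hkd hprod
      have h' : ((∏ p ∈ S, p : ℕ) : ℝ) ≤ ((k / d : ℕ) : ℝ) := by exact_mod_cast h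
      rw [Nat.cast_prod, Nat.cast_div hdk (by exact_mod_cast NeZero.ne d)] at h'
      exact h'
    have hpos : 0 < ∏ p ∈ S, (p : ℝ) :=
      Finset.prod_pos fun p hp ↦ by exact_mod_cast (hSprime p hp).pos
    calc ∑ p ∈ S, Real.log p = Real.log (∏ p ∈ S, (p : ℝ)) := by
          rw [Real.log_prod fun p hp ↦ by exact_mod_cast (hSprime p hp).ne_zero]
      _ ≤ Real.log ((k : ℝ) / d) := Real.log_le_log hpos hle
      _ = Real.log k - Real.log d := by
          rw [Real.log_div (by exact_mod_cast NeZero.ne k) (by exact_mod_cast NeZero.ne d)]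
  have hK := bigK_pos
  have := mul_le_mul_of_nonneg_left hlog hK.le
  rw [hrel]
  linarith

end Indices

/-! ## The assembled inequalities, by the order of `χ` (McCurley's (30) at `t = 0`) -/

section Assembly

open DirichletCharacter

variable {k : ℕ} [NeZero k] {χ : DirichletCharacter ℂ k} {β σ : ℝ}

/-- A real zero of `L(s, χ)` is a zero of `L(s, χ⁻¹)` (`χ ≠ 1`; reflection principle).
[cite: MontgomeryVaughan2007, §10.1] -/
theorem LFunction_inv_realZero (h1 : χ ≠ 1) (hz : χ.LFunction β = 0) : χ⁻¹.LFunction β = 0 := by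
  have h := DirichletZFR.conj_LFunction_conj χ h1 (β : ℂ)
  rw [Complex.conj_ofReal, hz, map_zero] at h
  exact h.symm

omit [NeZero k] in
/-- `χ⁻¹` is primitive when `χ` is. [folklore] -/
private theorem isPrimitive_inv (hχ : χ.IsPrimitive) : χ⁻¹.IsPrimitive := by
  rw [DirichletCharacter.isPrimitive_def, DirichletCharacter.conductor_inv]; exact hχ

/-- `Σ_{p∣k} T(p,σ) = (a₂+a₃+a₄) Σ max(G,0) − a₀ Σ help`. [cite: McCurley1984ZFR, §4 (36)] -/
private theorem sum_tPen_eq (k : ℕ) (σ : ℝ) :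
    ∑ p ∈ k.primeFactors, tPen p σ =
      rsA234 * ∑ p ∈ k.primeFactors, max (gPen p σ) 0
        - rsA0 * ∑ p ∈ k.primeFactors, (uCorr p σ - kappa * uCorr p (sigmaOne σ)) := by
  simp only [tPen]
  rw [Finset.sum_sub_distrib, ← Finset.mul_sum, ← Finset.mul_sum]

/-- The help sum is non-negative. [cite: McCurley1984ZFR, §2 (`s(k) > 0`)] -/
private theorem sum_help_nonneg (k : ℕ) (hσ : 1 < σ) :
    0 ≤ ∑ p ∈ k.primeFactors, (uCorr p σ - kappa * uCorr p (sigmaOne σ)) :=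
  Finset.sum_nonneg fun _ hp ↦ help_nonneg (Nat.prime_of_mem_primeFactors hp).two_le hσ

/-- The penalty sum is non-negative. [folklore] -/
private theorem sum_maxG_nonneg (k : ℕ) (σ : ℝ) : 0 ≤ ∑ p ∈ k.primeFactors, max (gPen p σ) 0 :=
  Finset.sum_nonneg fun _ _ ↦ le_max_right _ _

/-- **Generic order (`χ³, χ⁴, χ⁵ ≠ 1`, besides `χ, χ² ≠ 1`):**
`a₁/(σ−β) ≤ a₀/(σ−1) + K·A·log k − 3.5`, `A = a₁+a₂+a₃+a₄`, for `1 < σ ≤ 1.3`.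
[cite: McCurley1984ZFR, §4 (30), §5 (first display), (37)] -/
theorem assembled_generic (hχ : χ.IsPrimitive) (h1 : χ ≠ 1) (h2 : χ ^ 2 ≠ 1) (h3 : χ ^ 3 ≠ 1)
    (h4 : χ ^ 4 ≠ 1) (hβ0 : 0 < β) (hβh : β ≠ 1 / 2) (hβ1 : β ≤ 1) (hz : χ.LFunction β = 0)
    (hσ : 1 < σ) (hσ' : σ ≤ 1.3) :
    rsA1 / (σ - β) ≤ rsA0 / (σ - 1) + bigK * (rsA1 + rsA2 + rsA3 + rsA4) * Real.log k - 3.5 := by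
  have hpos := rosser_positivity χ hσ
  rw [pow_zero, pow_one] at hpos
  have H0 := fdiff_principal_le (k := k) hσ hσ'
  have H1 := fdiff_zero_le χ hχ h1 hβ0 hβh hβ1 hz hσ hσ'
  have H2 := fdiff_induced_le (χ ^ 2) h2 hσ hσ'
  have H3 := fdiff_induced_le (χ ^ 3) h3 hσ hσ'
  have H4 := fdiff_induced_le (χ ^ 4) h4 hσ hσ'
  have HT := sum_tPen_le k hσ hσ'
  rw [sum_tPen_eq, rsA234] at HT
  have hh := sum_help_nonneg k hσ
  have hm := sum_maxG_nonneg k σ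
  have a0 : (0 : ℝ) ≤ rsA0 := by norm_num [rsA0]
  have a1 : (0 : ℝ) ≤ rsA1 := by norm_num [rsA1]
  have a2 : (0 : ℝ) ≤ rsA2 := by norm_num [rsA2]
  have a3 : (0 : ℝ) ≤ rsA3 := by norm_num [rsA3]
  have a4 : (0 : ℝ) ≤ rsA4 := by norm_num [rsA4]
  have e0 := mul_le_mul_of_nonneg_left H0 a0
  have e1 := mul_le_mul_of_nonneg_left H1 a1
  have e2 := mul_le_mul_of_nonneg_left H2 a2
  have e3 := mul_le_mul_of_nonneg_left H3 a3
  have e4 := mul_le_mul_of_nonneg_left H4 a4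
  have hc : (16.19 : ℝ) - 0.325 * rsA0 - 0.44 * (rsA1 + rsA2 + rsA3 + rsA4) ≤ -3.5 := by
    norm_num [rsA0, rsA1, rsA2, rsA3, rsA4]
  have key : rsA1 * (1 / (σ - β)) ≤ rsA0 * (1 / (σ - 1))
      + bigK * (rsA1 + rsA2 + rsA3 + rsA4) * Real.log k - 3.5 := by
    nlinarith [e0, e1, e2, e3, e4, hpos, HT, hh, hm, hc]
  simpa only [mul_one_div] using key

/-- **Order 5 (`χ⁵ = 1`, `χ ≠ 1`):** then `χ⁴ = χ̄` carries the zero too: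
`(a₁+a₄)/(σ−β) ≤ a₀/(σ−1) + K·A·log k − 3.5`. [cite: McCurley1984ZFR, §4 (30), §5, (37)] -/
theorem assembled_order_five (hχ : χ.IsPrimitive) (h1 : χ ≠ 1) (h2 : χ ^ 2 ≠ 1) (h3 : χ ^ 3 ≠ 1)
    (h5 : χ ^ 5 = 1) (hβ0 : 0 < β) (hβh : β ≠ 1 / 2) (hβ1 : β ≤ 1) (hz : χ.LFunction β = 0)
    (hσ : 1 < σ) (hσ' : σ ≤ 1.3) :
    (rsA1 + rsA4) / (σ - β) ≤
      rsA0 / (σ - 1) + bigK * (rsA1 + rsA2 + rsA3 + rsA4) * Real.log k - 3.5 := by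
  have hpos := rosser_positivity χ hσ
  rw [pow_zero, pow_one] at hpos
  have h4inv : χ ^ 4 = χ⁻¹ := by
    rw [eq_inv_iff_mul_eq_one, ← pow_succ]; exact h5
  have H0 := fdiff_principal_le (k := k) hσ hσ'
  have H1 := fdiff_zero_le χ hχ h1 hβ0 hβh hβ1 hz hσ hσ'
  have H2 := fdiff_induced_le (χ ^ 2) h2 hσ hσ'
  have H3 := fdiff_induced_le (χ ^ 3) h3 hσ hσ'
  have H4 := fdiff_zero_le χ⁻¹ (isPrimitive_inv hχ) (inv_ne_one.mpr h1) hβ0 hβh hβ1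
    (LFunction_inv_realZero h1 hz) hσ hσ'
  rw [← h4inv] at H4
  have HT := sum_tPen_le k hσ hσ'
  rw [sum_tPen_eq, rsA234] at HT
  have hh := sum_help_nonneg k hσ
  have hm := sum_maxG_nonneg k σ
  have a0 : (0 : ℝ) ≤ rsA0 := by norm_num [rsA0]
  have a1 : (0 : ℝ) ≤ rsA1 := by norm_num [rsA1]
  have a2 : (0 : ℝ) ≤ rsA2 := by norm_num [rsA2]
  have a3 : (0 : ℝ) ≤ rsA3 := by norm_num [rsA3]
  have a4 : (0 : ℝ) ≤ rsA4 := by norm_num [rsA4]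
  have e0 := mul_le_mul_of_nonneg_left H0 a0
  have e1 := mul_le_mul_of_nonneg_left H1 a1
  have e2 := mul_le_mul_of_nonneg_left H2 a2
  have e3 := mul_le_mul_of_nonneg_left H3 a3
  have e4 := mul_le_mul_of_nonneg_left H4 a4
  have hc : (16.19 : ℝ) - 0.325 * rsA0 - 0.44 * (rsA1 + rsA2 + rsA3 + rsA4) ≤ -3.5 := by
    norm_num [rsA0, rsA1, rsA2, rsA3, rsA4]
  have key : (rsA1 + rsA4) * (1 / (σ - β)) ≤ rsA0 * (1 / (σ - 1))
      + bigK * (rsA1 + rsA2 + rsA3 + rsA4) * Real.log k - 3.5 := by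
    nlinarith [e0, e1, e2, e3, e4, hpos, HT, hh, hm, hc]
  simpa only [mul_one_div] using key

/-- **Order 4 (`χ⁴ = 1`, `χ² ≠ 1`):** `χ³ = χ̄` carries the zero, `χ⁴ = χ₀` the pole:
`(a₁+a₃)/(σ−β) ≤ (a₀+a₄)/(σ−1) + K·(a₁+a₂+a₃)·log k − 3.39`.
[cite: McCurley1984ZFR, §4 (30), §5 (40)–(42)] -/
theorem assembled_order_four (hχ : χ.IsPrimitive) (h1 : χ ≠ 1) (h2 : χ ^ 2 ≠ 1) (h4 : χ ^ 4 = 1)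
    (hβ0 : 0 < β) (hβh : β ≠ 1 / 2) (hβ1 : β ≤ 1) (hz : χ.LFunction β = 0)
    (hσ : 1 < σ) (hσ' : σ ≤ 1.3) :
    (rsA1 + rsA3) / (σ - β) ≤
      (rsA0 + rsA4) / (σ - 1) + bigK * (rsA1 + rsA2 + rsA3) * Real.log k - 3.39 := by
  have hpos := rosser_positivity χ hσ
  rw [pow_zero, pow_one] at hpos
  have h3inv : χ ^ 3 = χ⁻¹ := by
    rw [eq_inv_iff_mul_eq_one, ← pow_succ]; exact h4
  have H0 := fdiff_principal_le (k := k) hσ hσ'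
  have H1 := fdiff_zero_le χ hχ h1 hβ0 hβh hβ1 hz hσ hσ'
  have H2 := fdiff_induced_le (χ ^ 2) h2 hσ hσ'
  have H3 := fdiff_zero_le χ⁻¹ (isPrimitive_inv hχ) (inv_ne_one.mpr h1) hβ0 hβh hβ1
    (LFunction_inv_realZero h1 hz) hσ hσ'
  rw [← h3inv] at H3
  have H4 : fdiff (χ ^ 4) σ ≤
      1 / (σ - 1) - 0.325 - ∑ p ∈ k.primeFactors, (uCorr p σ - kappa * uCorr p (sigmaOne σ)) := by
    rw [h4]; exact H0
  have HT := sum_tPen_le k hσ hσ'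
  rw [sum_tPen_eq, rsA234] at HT
  have hh := sum_help_nonneg k hσ
  have hm := sum_maxG_nonneg k σ
  have a0 : (0 : ℝ) ≤ rsA0 := by norm_num [rsA0]
  have a1 : (0 : ℝ) ≤ rsA1 := by norm_num [rsA1]
  have a2 : (0 : ℝ) ≤ rsA2 := by norm_num [rsA2]
  have a3 : (0 : ℝ) ≤ rsA3 := by norm_num [rsA3]
  have a4 : (0 : ℝ) ≤ rsA4 := by norm_num [rsA4]
  have e0 := mul_le_mul_of_nonneg_left H0 a0
  have e1 := mul_le_mul_of_nonneg_left H1 a1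
  have e2 := mul_le_mul_of_nonneg_left H2 a2
  have e3 := mul_le_mul_of_nonneg_left H3 a3
  have e4 := mul_le_mul_of_nonneg_left H4 a4
  have hc : (16.19 : ℝ) - 0.325 * (rsA0 + rsA4) - 0.44 * (rsA1 + rsA2 + rsA3) ≤ -3.39 := by
    norm_num [rsA0, rsA1, rsA2, rsA3, rsA4]
  have hA : rsA2 ≤ rsA2 + rsA3 + rsA4 := by linarith
  have hm2 : rsA2 * ∑ p ∈ k.primeFactors, max (gPen p σ) 0 ≤
      (rsA2 + rsA3 + rsA4) * ∑ p ∈ k.primeFactors, max (gPen p σ) 0 :=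
    mul_le_mul_of_nonneg_right hA hm
  have hh4 : 0 ≤ rsA4 * ∑ p ∈ k.primeFactors, (uCorr p σ - kappa * uCorr p (sigmaOne σ)) :=
    mul_nonneg a4 hh
  have key : (rsA1 + rsA3) * (1 / (σ - β)) ≤ (rsA0 + rsA4) * (1 / (σ - 1))
      + bigK * (rsA1 + rsA2 + rsA3) * Real.log k - 3.39 := by
    nlinarith [e0, e1, e2, e3, e4, hpos, HT, hh, hm, hc, hm2, hh4]
  simpa only [mul_one_div] using key

/-- **Order 3 (`χ³ = 1`, `χ ≠ 1`):** `χ² = χ̄` and `χ⁴ = χ` carry the zero, `χ³ = χ₀` the pole;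
no induced corrections at all:
`(a₁+a₂+a₄)/(σ−β) ≤ (a₀+a₃)/(σ−1) + K·(a₁+a₂+a₄)·log k − 19`.
[cite: McCurley1984ZFR, §4 (30), (33), §6] -/
theorem assembled_order_three (hχ : χ.IsPrimitive) (h1 : χ ≠ 1) (h3 : χ ^ 3 = 1)
    (hβ0 : 0 < β) (hβh : β ≠ 1 / 2) (hβ1 : β ≤ 1) (hz : χ.LFunction β = 0)
    (hσ : 1 < σ) (hσ' : σ ≤ 1.3) :
    (rsA1 + rsA2 + rsA4) / (σ - β) ≤
      (rsA0 + rsA3) / (σ - 1) + bigK * (rsA1 + rsA2 + rsA4) * Real.log k - 19 := by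
  have hpos := rosser_positivity χ hσ
  rw [pow_zero, pow_one] at hpos
  have h2inv : χ ^ 2 = χ⁻¹ := by
    rw [eq_inv_iff_mul_eq_one, ← pow_succ]; exact h3
  have h4eq : χ ^ 4 = χ := by
    rw [pow_succ, h3, one_mul]
  have H0 := fdiff_principal_le (k := k) hσ hσ'
  have H1 := fdiff_zero_le χ hχ h1 hβ0 hβh hβ1 hz hσ hσ'
  have H2 := fdiff_zero_le χ⁻¹ (isPrimitive_inv hχ) (inv_ne_one.mpr h1) hβ0 hβh hβ1
    (LFunction_inv_realZero h1 hz) hσ hσ'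
  rw [← h2inv] at H2
  have H3 : fdiff (χ ^ 3) σ ≤
      1 / (σ - 1) - 0.325 - ∑ p ∈ k.primeFactors, (uCorr p σ - kappa * uCorr p (sigmaOne σ)) := by
    rw [h3]; exact H0
  have H4 : fdiff (χ ^ 4) σ ≤ bigK * Real.log k - 0.44 - 1 / (σ - β) := by rw [h4eq]; exact H1
  have hh := sum_help_nonneg k hσ
  have a0 : (0 : ℝ) ≤ rsA0 := by norm_num [rsA0]
  have a1 : (0 : ℝ) ≤ rsA1 := by norm_num [rsA1]
  have a2 : (0 : ℝ) ≤ rsA2 := by norm_num [rsA2]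
  have a3 : (0 : ℝ) ≤ rsA3 := by norm_num [rsA3]
  have a4 : (0 : ℝ) ≤ rsA4 := by norm_num [rsA4]
  have e0 := mul_le_mul_of_nonneg_left H0 a0
  have e1 := mul_le_mul_of_nonneg_left H1 a1
  have e2 := mul_le_mul_of_nonneg_left H2 a2
  have e3 := mul_le_mul_of_nonneg_left H3 a3
  have e4 := mul_le_mul_of_nonneg_left H4 a4
  have hc : -0.325 * (rsA0 + rsA3) - 0.44 * (rsA1 + rsA2 + rsA4) ≤ (-19 : ℝ) := by
    norm_num [rsA0, rsA1, rsA2, rsA3, rsA4]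
  have hh03 : 0 ≤ (rsA0 + rsA3) * ∑ p ∈ k.primeFactors, (uCorr p σ - kappa * uCorr p (sigmaOne σ)) :=
    mul_nonneg (by linarith) hh
  have key : (rsA1 + rsA2 + rsA4) * (1 / (σ - β)) ≤ (rsA0 + rsA3) * (1 / (σ - 1))
      + bigK * (rsA1 + rsA2 + rsA4) * Real.log k - 19 := by
    nlinarith [e0, e1, e2, e3, e4, hpos, hh, hc, hh03]
  simpa only [mul_one_div] using key

end Assembly


/-! ## The optimisation `σ = 1 + r/log M` and the exclusion of real zeros for complex characters -/

section Endgame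

open DirichletCharacter

/-- McCurley's (near-)optimal `r = (√(a₀a₁) − a₀)/(K·A) = 0.339013351752…` (he prints the
approximation `0.33901`). [cite: McCurley1984ZFR, §4 (after (30))] -/
def rOpt : ℝ := 0.339013351753

/-- `√5 < 2.2360679774997896965` (19 decimals; needed because the printed constant
`R = 9.645908801` is the exact optimum `K·A/(√a₁ − √a₀)² = 9.645 908 800 268…` rounded up in the
tenth digit). [folklore] -/
private theorem sqrt5_lt_precise : Real.sqrt 5 < 2.2360679774997896965 := by
  rw [show (2.2360679774997896965 : ℝ) = Real.sqrt (2.2360679774997896965 ^ 2) by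
    rw [Real.sqrt_sq (by norm_num)]]
  exact Real.sqrt_lt_sqrt (by norm_num) (by norm_num)

/-- `K = (1 − 1/√5)/2 ≤ (1 − 1/2.2360679774997896965)/2`. [cite: McCurley1984ZFR, §2 (`K`)] -/
theorem bigK_le_precise : bigK ≤ (1 - (2.2360679774997896965 : ℝ)⁻¹) / 2 := by
  have h5 : 0 < Real.sqrt 5 := Real.sqrt_pos.2 (by norm_num)
  have hk : (2.2360679774997896965 : ℝ)⁻¹ ≤ kappa := by
    unfold kappa
    exact (inv_le_inv₀ (by norm_num) h5).2 sqrt5_lt_precise.le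
  unfold bigK
  linarith

/-- **The numerical heart (generic order):** `a₁/(r + 1/R) > a₀/r + K·A` for `r = rOpt`,
`R = 9.645908801`, `A = a₁+a₂+a₃+a₄` — equivalently `a₁r/(a₀ + KAr) − r > 1/R`; the margin is
`7.9·10⁻¹²` (McCurley: "If we choose `r = 0.33901`, then `a₁r/(a₀ + κAr) − r > 1/R`", margin
`1.1·10⁻¹³`). [cite: McCurley1984ZFR, §4 (30)] -/
theorem numeric_generic :
    rsA0 / rOpt + bigK * (rsA1 + rsA2 + rsA3 + rsA4) < rsA1 / (rOpt + 1 / 9.645908801) := by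
  have hK := bigK_le_precise
  have hA : (0 : ℝ) ≤ rsA1 + rsA2 + rsA3 + rsA4 := by norm_num [rsA1, rsA2, rsA3, rsA4]
  have h1 : bigK * (rsA1 + rsA2 + rsA3 + rsA4) ≤
      (1 - (2.2360679774997896965 : ℝ)⁻¹) / 2 * (rsA1 + rsA2 + rsA3 + rsA4) :=
    mul_le_mul_of_nonneg_right hK hA
  have h2 : rsA0 / rOpt + (1 - (2.2360679774997896965 : ℝ)⁻¹) / 2 * (rsA1 + rsA2 + rsA3 + rsA4)
      < rsA1 / (rOpt + 1 / 9.645908801) := by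
    norm_num [rsA0, rsA1, rsA2, rsA3, rsA4, rOpt]
  linarith

/-- Order 5: `(a₁+a₄)/(r + 1/R) > a₀/r + K·A`. [cite: McCurley1984ZFR, §4 (30)] -/
theorem numeric_order_five :
    rsA0 / rOpt + bigK * (rsA1 + rsA2 + rsA3 + rsA4) < (rsA1 + rsA4) / (rOpt + 1 / 9.645908801) := by
  have hK := bigK_lt
  have hA : (0 : ℝ) ≤ rsA1 + rsA2 + rsA3 + rsA4 := by norm_num [rsA1, rsA2, rsA3, rsA4]
  have h1 : bigK * (rsA1 + rsA2 + rsA3 + rsA4) ≤ 0.276395 * (rsA1 + rsA2 + rsA3 + rsA4) :=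
    mul_le_mul_of_nonneg_right hK.le hA
  have h2 : rsA0 / rOpt + 0.276395 * (rsA1 + rsA2 + rsA3 + rsA4)
      < (rsA1 + rsA4) / (rOpt + 1 / 9.645908801) := by
    norm_num [rsA0, rsA1, rsA2, rsA3, rsA4, rOpt]
  linarith

/-- Order 4: `(a₁+a₃)/(r + 1/R) > (a₀+a₄)/r + K·(a₁+a₂+a₃)`. [cite: McCurley1984ZFR, §4 (30)] -/
theorem numeric_order_four :
    (rsA0 + rsA4) / rOpt + bigK * (rsA1 + rsA2 + rsA3) < (rsA1 + rsA3) / (rOpt + 1 / 9.645908801) := by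
  have hK := bigK_lt
  have hA : (0 : ℝ) ≤ rsA1 + rsA2 + rsA3 := by norm_num [rsA1, rsA2, rsA3]
  have h1 : bigK * (rsA1 + rsA2 + rsA3) ≤ 0.276395 * (rsA1 + rsA2 + rsA3) :=
    mul_le_mul_of_nonneg_right hK.le hA
  have h2 : (rsA0 + rsA4) / rOpt + 0.276395 * (rsA1 + rsA2 + rsA3)
      < (rsA1 + rsA3) / (rOpt + 1 / 9.645908801) := by
    norm_num [rsA0, rsA1, rsA2, rsA3, rsA4, rOpt]
  linarith

/-- Order 3: `(a₁+a₂+a₄)/(r + 1/R) > (a₀+a₃)/r + K·(a₁+a₂+a₄)`. [cite: McCurley1984ZFR, §4 (30)] -/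
theorem numeric_order_three :
    (rsA0 + rsA3) / rOpt + bigK * (rsA1 + rsA2 + rsA4) <
      (rsA1 + rsA2 + rsA4) / (rOpt + 1 / 9.645908801) := by
  have hK := bigK_lt
  have hA : (0 : ℝ) ≤ rsA1 + rsA2 + rsA4 := by norm_num [rsA1, rsA2, rsA4]
  have h1 : bigK * (rsA1 + rsA2 + rsA4) ≤ 0.276395 * (rsA1 + rsA2 + rsA4) :=
    mul_le_mul_of_nonneg_right hK.le hA
  have h2 : (rsA0 + rsA3) / rOpt + 0.276395 * (rsA1 + rsA2 + rsA4)
      < (rsA1 + rsA2 + rsA4) / (rOpt + 1 / 9.645908801) := by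
    norm_num [rsA0, rsA1, rsA2, rsA3, rsA4, rOpt]
  linarith

/-- **The endgame of (30).** If `c/(σ−β) ≤ P₀/(σ−1) + K'·L + C` at `σ = 1 + r/L` with `C ≤ 0`,
`β ≥ 1 − b₀/L`, `β < σ`, and `c/(r + b₀) > P₀/r + K'`, we have a contradiction.
(`σ − 1 = r/L`, `σ − β ≤ (r+b₀)/L`; divide by `L`.) [cite: McCurley1984ZFR, §4 (30)] -/
theorem endgame_contra {c P₀ K' C L β r b₀ : ℝ} (hL : 0 < L) (hr : 0 < r) (hb : 0 < b₀) (hc : 0 < c)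
    (hC : C ≤ 0) (hβ : 1 - b₀ / L ≤ β) (hβσ : β < 1 + r / L)
    (hmain : c / (1 + r / L - β) ≤ P₀ / (1 + r / L - 1) + K' * L + C)
    (hnum : P₀ / r + K' < c / (r + b₀)) : False := by
  have hden : 0 < 1 + r / L - β := by linarith
  have hden' : 1 + r / L - β ≤ (r + b₀) / L := by
    have : (r + b₀) / L = r / L + b₀ / L := by ring
    linarith
  have hrb : 0 < r + b₀ := by linarith
  -- `c L/(r+b₀) ≤ c/(σ−β)`
  have h1 : c / ((r + b₀) / L) ≤ c / (1 + r / L - β) :=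
    div_le_div_of_nonneg_left hc.le hden hden'
  have e1 : c / ((r + b₀) / L) = L * (c / (r + b₀)) := by
    field_simp
  have e2 : P₀ / (1 + r / L - 1) = L * (P₀ / r) := by
    rw [show 1 + r / L - 1 = r / L by ring, div_div_eq_mul_div]
    field_simp
  rw [e1] at h1
  rw [e2] at hmain
  have h3 : L * (c / (r + b₀)) ≤ L * (P₀ / r + K') := by nlinarith
  have h4 : c / (r + b₀) ≤ P₀ / r + K' := le_of_mul_le_mul_left h3 hL
  linarith

/-- `log 10 ≥ 2.302585` (from the tree's `log 2` and our `log 5` enclosures). [folklore] -/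
private theorem log_ten_ge : (2.302585 : ℝ) ≤ Real.log 10 := by
  have h : Real.log 10 = Real.log 2 + Real.log 5 := by
    rw [show (10 : ℝ) = 2 * 5 by norm_num, Real.log_mul (by norm_num) (by norm_num)]
  rw [h]
  have h2 := Real.log_two_gt_d9
  have h5 := log_five_bounds.1
  linarith

/-- **No real zero for a COMPLEX primitive character in McCurley's window.** Let `χ` be a
primitive character mod `k` with `χ² ≠ χ₀` (i.e. `χ` complex), and `β` a real zero of `L(s, χ)`.
Then `β < 1 − 1/(R log max(k, 10))`, `R = 9.645908801`. (McCurley's Theorem 1 at `t = 0` for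
complex characters: positivity with `P(θ)`, the bounds of §2 at real points, the imprimitive
corrections of the powers `χ², χ³, χ⁴`, and the choice `σ = 1 + r/log M`; the cases `χ³ = χ₀`,
`χ⁴ = χ₀`, `χ⁵ = χ₀` use that `χ̄` is among the powers and carries the zero as well.)
[cite: McCurley1984ZFR, Theorem 1 (p. 8), §4 (27)–(30), §5, §6] -/
theorem realZero_lt_of_sq_ne_one_primitive {k : ℕ} [NeZero k] {χ : DirichletCharacter ℂ k}
    (hχ : χ.IsPrimitive) (h2 : χ ^ 2 ≠ 1) {β : ℝ} (hz : χ.LFunction β = 0) :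
    β < 1 - 1 / (9.645908801 * Real.log (max (k : ℝ) 10)) := by
  by_contra hcon
  have hβw : 1 - 1 / (9.645908801 * Real.log (max (k : ℝ) 10)) ≤ β := not_lt.1 hcon
  have h1 : χ ≠ 1 := fun h ↦ h2 (by rw [h, one_pow])
  set L : ℝ := Real.log (max (k : ℝ) 10) with hLdef
  have hk0 : (0 : ℝ) < k := by exact_mod_cast Nat.pos_of_ne_zero (NeZero.ne k)
  have hL10 : Real.log 10 ≤ L := Real.log_le_log (by norm_num) (le_max_right _ _)
  have hL : 2.302585 ≤ L := log_ten_ge.trans hL10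
  have hLpos : 0 < L := by linarith
  have hlogk : Real.log k ≤ L := Real.log_le_log hk0 (le_max_left _ _)
  set b₀ : ℝ := 1 / 9.645908801 with hb₀def
  have hb₀ : 0 < b₀ := by norm_num [hb₀def]
  have hβw' : 1 - b₀ / L ≤ β := by
    have : 1 / (9.645908801 * L) = b₀ / L := by rw [hb₀def, div_div, one_div]
    rw [← this]; exact hβw
  have hbL : b₀ / L ≤ 0.0451 := by
    rw [div_le_iff₀ hLpos]; norm_num [hb₀def]; linarith
  have hβ0 : 0 < β := by linarith
  have hβh : β ≠ 1 / 2 := by intro h; rw [h] at hβw'; linarith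
  have hβ1 : β < 1 := by
    by_contra hb
    exact LFunction_ne_zero_of_one_le_re χ (Or.inl h1) (by simpa using not_lt.1 hb) hz
  -- `σ = 1 + r/L`
  set σ : ℝ := 1 + rOpt / L with hσdef
  have hr : (0 : ℝ) < rOpt := by norm_num [rOpt]
  have hσ1 : 1 < σ := by have := div_pos hr hLpos; linarith
  have hσ13 : σ ≤ 1.3 := by
    have : rOpt / L ≤ 0.15 := by rw [div_le_iff₀ hLpos]; norm_num [rOpt]; linarith
    linarith
  have hβσ : β < 1 + rOpt / L := by linarith
  have hKpos := bigK_pos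
  -- the four cases
  by_cases h3 : χ ^ 3 = 1
  · have hm := assembled_order_three hχ h1 h3 hβ0 hβh hβ1.le hz hσ1 hσ13
    have hc : (0 : ℝ) < rsA1 + rsA2 + rsA4 := by norm_num [rsA1, rsA2, rsA4]
    refine endgame_contra (K' := bigK * (rsA1 + rsA2 + rsA4)) (C := -19) hLpos hr hb₀ hc
      (by norm_num) hβw' hβσ ?_ numeric_order_three
    have : bigK * (rsA1 + rsA2 + rsA4) * Real.log k ≤ bigK * (rsA1 + rsA2 + rsA4) * L :=
      mul_le_mul_of_nonneg_left hlogk (mul_nonneg hKpos.le hc.le)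
    linarith
  by_cases h4 : χ ^ 4 = 1
  · have hm := assembled_order_four hχ h1 h2 h4 hβ0 hβh hβ1.le hz hσ1 hσ13
    have hc : (0 : ℝ) < rsA1 + rsA3 := by norm_num [rsA1, rsA3]
    have hc' : (0 : ℝ) ≤ rsA1 + rsA2 + rsA3 := by norm_num [rsA1, rsA2, rsA3]
    refine endgame_contra (K' := bigK * (rsA1 + rsA2 + rsA3)) (C := -3.39) hLpos hr hb₀ hc
      (by norm_num) hβw' hβσ ?_ numeric_order_four
    have : bigK * (rsA1 + rsA2 + rsA3) * Real.log k ≤ bigK * (rsA1 + rsA2 + rsA3) * L :=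
      mul_le_mul_of_nonneg_left hlogk (mul_nonneg hKpos.le hc')
    linarith
  by_cases h5 : χ ^ 5 = 1
  · have hm := assembled_order_five hχ h1 h2 h3 h5 hβ0 hβh hβ1.le hz hσ1 hσ13
    have hc : (0 : ℝ) < rsA1 + rsA4 := by norm_num [rsA1, rsA4]
    have hc' : (0 : ℝ) ≤ rsA1 + rsA2 + rsA3 + rsA4 := by norm_num [rsA1, rsA2, rsA3, rsA4]
    refine endgame_contra (K' := bigK * (rsA1 + rsA2 + rsA3 + rsA4)) (C := -3.5) hLpos hr hb₀ hc
      (by norm_num) hβw' hβσ ?_ numeric_order_five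
    have : bigK * (rsA1 + rsA2 + rsA3 + rsA4) * Real.log k ≤
        bigK * (rsA1 + rsA2 + rsA3 + rsA4) * L :=
      mul_le_mul_of_nonneg_left hlogk (mul_nonneg hKpos.le hc')
    linarith
  · have hm := assembled_generic hχ h1 h2 h3 h4 hβ0 hβh hβ1.le hz hσ1 hσ13
    have hc : (0 : ℝ) < rsA1 := by norm_num [rsA1]
    have hc' : (0 : ℝ) ≤ rsA1 + rsA2 + rsA3 + rsA4 := by norm_num [rsA1, rsA2, rsA3, rsA4]
    refine endgame_contra (K' := bigK * (rsA1 + rsA2 + rsA3 + rsA4)) (C := -3.5) hLpos hr hb₀ hc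
      (by norm_num) hβw' hβσ ?_ numeric_generic
    have : bigK * (rsA1 + rsA2 + rsA3 + rsA4) * Real.log k ≤
        bigK * (rsA1 + rsA2 + rsA3 + rsA4) * L :=
      mul_le_mul_of_nonneg_left hlogk (mul_nonneg hKpos.le hc')
    linarith

/-- Every character mod `1` or mod `2` is principal, so a character with `χ² ≠ χ₀` has
conductor `≥ 3`. [folklore] -/
private theorem eq_one_of_level_le_two {n : ℕ} [NeZero n] (hn : n ≤ 2) (χ : DirichletCharacter ℂ n) :
    χ = 1 := by
  have hn' : n = 1 ∨ n = 2 := by have := NeZero.ne n; omega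
  rcases hn' with rfl | rfl
  · exact DirichletCharacter.level_one χ
  · exact MulChar.ext fun u ↦ by rw [Subsingleton.elim u 1]; simp

/-- **No real zero for a COMPLEX character (any modulus) in McCurley's window**: for `χ` mod `q`
with `χ² ≠ χ₀` and a real zero `β > 0` of `L(s, χ)`: `β < 1 − 1/(R log max(q, 10))`,
`R = 9.645908801`. (Reduction to the primitive character `χ⋆` mod `d ∣ q`: the Euler factors
`1 − χ⋆(p)p^{−β}` do not vanish for `β > 0`, `χ⋆² ≠ χ₀`, and `max(d,10) ≤ max(q,10)`.)
[cite: McCurley1984ZFR, Theorem 1 (p. 8)] -/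
theorem realZero_lt_of_sq_ne_one {q : ℕ} [NeZero q] (χ : DirichletCharacter ℂ q) (h2 : χ ^ 2 ≠ 1)
    {β : ℝ} (hβ0 : 0 < β) (hz : χ.LFunction β = 0) :
    β < 1 - 1 / (9.645908801 * Real.log (max (q : ℝ) 10)) := by
  classical
  have h1 : χ ≠ 1 := fun h ↦ h2 (by rw [h, one_pow])
  haveI : NeZero χ.conductor := ⟨conductor_ne_zero χ⟩
  set d := χ.conductor with hddef
  set χ₁ := χ.primitiveCharacter with hχ₁def
  have hind : changeLevel χ.conductor_dvd_level χ₁ = χ := changeLevel_primitiveCharacter χ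
  have hχ₁p : χ₁.IsPrimitive := primitiveCharacter_isPrimitive χ
  have hχ₁2 : χ₁ ^ 2 ≠ 1 := by
    intro h
    apply h2
    rw [← hind, ← map_pow, h]
    exact changeLevel_one _
  -- the zero passes to `χ₁`
  have hβ1 : β < 1 := by
    by_contra hb
    exact LFunction_ne_zero_of_one_le_re χ (Or.inl h1) (by simpa using not_lt.1 hb) hz
  have hβne : (β : ℂ) ≠ 1 := by
    intro h; have := congrArg Complex.re h; simp at this; linarith
  have hz₁ : χ₁.LFunction β = 0 := by
    have h := LFunction_changeLevel χ.conductor_dvd_level χ₁ (s := (β : ℂ)) (Or.inr hβne)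
    rw [hind, hz] at h
    have hE : (∏ p ∈ q.primeFactors, (1 - χ₁ p * (p : ℂ) ^ (-(β : ℂ)))) ≠ 0 :=
      Finset.prod_ne_zero_iff.2 fun p hp ↦
        (logDeriv_eulerFactorC (Nat.prime_of_mem_primeFactors hp).two_le (χ₁.norm_le_one _) hβ0).1
    rcases mul_eq_zero.1 h.symm with h0 | h0
    · exact h0
    · exact absurd h0 hE
  have hlt := realZero_lt_of_sq_ne_one_primitive hχ₁p hχ₁2 hz₁
  -- compare the windows: `max(d,10) ≤ max(q,10)`
  have hdq : (d : ℝ) ≤ q := by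
    exact_mod_cast Nat.le_of_dvd (Nat.pos_of_ne_zero (NeZero.ne q)) χ.conductor_dvd_level
  have hmax : max (d : ℝ) 10 ≤ max (q : ℝ) 10 := max_le_max hdq le_rfl
  have hpos : (0 : ℝ) < max (d : ℝ) 10 := lt_of_lt_of_le (by norm_num) (le_max_right _ _)
  have hlog : Real.log (max (d : ℝ) 10) ≤ Real.log (max (q : ℝ) 10) := Real.log_le_log hpos hmax
  have hL10 : Real.log 10 ≤ Real.log (max (d : ℝ) 10) :=
    Real.log_le_log (by norm_num) (le_max_right _ _)
  have hLd : 0 < Real.log (max (d : ℝ) 10) := by linarith [log_ten_ge]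
  have hmono : 1 / (9.645908801 * Real.log (max (q : ℝ) 10)) ≤
      1 / (9.645908801 * Real.log (max (d : ℝ) 10)) :=
    one_div_le_one_div_of_le (by positivity) (by nlinarith)
  linarith

end Endgame

end McCurleyStechkin

/-! ## McCurley's Theorem 1: the real-zero clause, PROVED -/

open McCurleyStechkin ThornerZaman2024 DirichletCharacter in
/-- **A real zero in McCurley's window belongs to a quadratic non-principal character.** For
`q ≥ 1`, `χ` mod `q` and a real `β ≠ 1` with `1 − 1/(R log max(q,10)) ≤ β` and `L(β, χ) = 0`:
`χ ≠ χ₀`, `χ² = χ₀`, and `0 < β < 1`. (Principal `χ`: `L(β, χ₀) = ζ(β)∏_{p∣q}(1 − p^{−β}) ≠ 0` on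
`(0,1) ∪ (1,∞)`; complex `χ`: `realZero_lt_of_sq_ne_one`.) [cite: McCurley1984ZFR, Theorem 1 (p. 8)] -/
theorem McCurleyStechkin.quadratic_of_realZero_window {q : ℕ} [NeZero q] (χ : DirichletCharacter ℂ q)
    {β : ℝ} (hβ1 : β ≠ 1) (hβw : 1 - 1 / (9.645908801 * Real.log (max (q : ℝ) 10)) ≤ β)
    (hz : χ.LFunction β = 0) : χ ≠ 1 ∧ χ ^ 2 = 1 ∧ 0 < β ∧ β < 1 := by
  have hL10 : Real.log 10 ≤ Real.log (max (q : ℝ) 10) :=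
    Real.log_le_log (by norm_num) (le_max_right _ _)
  have hL : 2.302585 ≤ Real.log (max (q : ℝ) 10) := log_ten_ge.trans hL10
  have hLpos : 0 < Real.log (max (q : ℝ) 10) := by linarith
  have hwin : 1 / (9.645908801 * Real.log (max (q : ℝ) 10)) ≤ 0.0451 := by
    rw [div_le_iff₀ (by positivity)]; nlinarith
  have hβ0 : 0 < β := by linarith
  have hβne : (β : ℂ) ≠ 1 := fun h ↦ hβ1 (by exact_mod_cast h)
  -- principal character excluded
  have h1 : χ ≠ 1 := by
    intro hχ1
    subst hχ1
    rcases lt_or_gt_of_ne hβ1 with hb | hb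
    · -- `0 < β < 1`: `L(β, χ₀) = (∏ (1 − p^{−β})) ζ(β)` and `ζ(β) ≠ 0`
      have h := LFunctionTrivChar_eq_mul_riemannZeta (N := q) hβne
      rw [LFunctionTrivChar] at h
      rw [h] at hz
      rcases mul_eq_zero.1 hz with h0 | h0
      · refine absurd h0 (Finset.prod_ne_zero_iff.2 fun p hp ↦ ?_)
        have := (logDeriv_eulerFactorC (Nat.prime_of_mem_primeFactors hp).two_le
          (show ‖(1 : ℂ)‖ ≤ 1 by simp) hβ0).1
        simpa using this
      · exact riemannZeta_ne_zero_of_mem_Ioo_holds β hβ0 hb h0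
    · exact LFunction_ne_zero_of_one_le_re (1 : DirichletCharacter ℂ q) (Or.inr hβne)
        (by simpa using hb.le) hz
  -- complex characters excluded
  have hsq : χ ^ 2 = 1 := by
    by_contra h2
    have := realZero_lt_of_sq_ne_one χ h2 hβ0 hz
    linarith
  have hβlt : β < 1 := by
    by_contra hb
    exact LFunction_ne_zero_of_one_le_re χ (Or.inl h1) (by simpa using not_lt.1 hb) hz
  exact ⟨h1, hsq, hβ0, hβlt⟩

open McCurleyStechkin ThornerZaman2024 DirichletCharacter in
/-- **McCurley 1984, Theorem 1 — THE REAL-ZERO CLAUSE, PROVED** (the named fact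
`McCurley1984_theorem1_closed` = `AtMostOneZeroInClosedRegion 9.645908801 10` restricted to real
points). For every modulus `q ≥ 3`, characters `χ₁, χ₂` mod `q` and real `s₁, s₂ ≠ 1` in the closed
window `1 − 1/(R log max(q, 10)) ≤ sᵢ`, `R = 9.645908801`: if `L(s₁, χ₁) = L(s₂, χ₂) = 0` then
`(χ₁, s₁) = (χ₂, s₂)`, `χ₁ ≠ χ₀` and `χ₁² = χ₀` — at most one real zero of `∏_χ L(s, χ)` in the
window, simple as a zero of the product's real-character part, from a quadratic character.
Ingredients: `quadratic_of_realZero_window` (this file: principal and complex characters have no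
real zero there) and the tree's `McCurleyStechkin.realZeros_quadratic_sameModulus` (two quadratic
characters / two real zeros in the wider Page window `1 − 0.155/log q` coincide; McCurley's Thm 2
discharged). McCurley's `t ≠ 0` clauses (complex zeros) are NOT proved here.
[cite: McCurley1984ZFR, Theorem 1 (p. 8)] -/
theorem mccurley1984_theorem1_realZeros {q : ℕ} [NeZero q] (hq : 3 ≤ q)
    (χ₁ χ₂ : DirichletCharacter ℂ q) {s₁ s₂ : ℝ} (hs₁ : s₁ ≠ 1) (hs₂ : s₂ ≠ 1)
    (hr₁ : 1 - 1 / (9.645908801 * Real.log (max (q : ℝ) 10)) ≤ s₁)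
    (hr₂ : 1 - 1 / (9.645908801 * Real.log (max (q : ℝ) 10)) ≤ s₂)
    (hz₁ : χ₁.LFunction s₁ = 0) (hz₂ : χ₂.LFunction s₂ = 0) :
    (χ₁ = χ₂ ∧ s₁ = s₂) ∧ χ₁ ≠ 1 ∧ χ₁ ^ 2 = 1 := by
  obtain ⟨h11, hsq1, -, -⟩ := quadratic_of_realZero_window χ₁ hs₁ hr₁ hz₁
  obtain ⟨h21, hsq2, -, -⟩ := quadratic_of_realZero_window χ₂ hs₂ hr₂ hz₂
  have hquad1 : χ₁.IsQuadratic := MulChar.isQuadratic_iff_sq_eq_one.mpr hsq1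
  have hquad2 : χ₂.IsQuadratic := MulChar.isQuadratic_iff_sq_eq_one.mpr hsq2
  -- the window lies inside the Page window `1 − pageConst/log q`
  have hq3 : (3 : ℝ) ≤ q := by exact_mod_cast hq
  have hlogq : 1 < Real.log q := by
    rw [Real.lt_log_iff_exp_lt (by linarith)]
    have := Real.exp_one_lt_d9
    linarith
  have hMq : (q : ℝ) ≤ max (q : ℝ) 10 := le_max_left _ _
  have hlogM : Real.log q ≤ Real.log (max (q : ℝ) 10) := Real.log_le_log (by linarith) hMq
  have hzc0 : 0 < zfrConst := by unfold zfrConst; norm_num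
  have hzl : zfrConst ≤ pageConst := zfrConst_le_pageConst
  have e : 1 / (9.645908801 * Real.log (max (q : ℝ) 10)) = zfrConst / Real.log (max (q : ℝ) 10) := by
    unfold zfrConst; rw [div_div]
  have hc1 : zfrConst / Real.log (max (q : ℝ) 10) ≤ zfrConst / Real.log q :=
    div_le_div_of_nonneg_left hzc0.le (by linarith) hlogM
  have hc2 : zfrConst / Real.log q ≤ pageConst / Real.log q :=
    div_le_div_of_nonneg_right hzl (by linarith)
  have hw1 : 1 - pageConst / Real.log q ≤ s₁ := by rw [e] at hr₁; linarith
  have hw2 : 1 - pageConst / Real.log q ≤ s₂ := by rw [e] at hr₂; linarith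
  obtain ⟨hs, hχ⟩ := realZeros_quadratic_sameModulus hq χ₁ χ₂ hquad1 h11 hquad2 h21 hz₁ hz₂ hw1 hw2
  exact ⟨⟨hχ, hs⟩, h11, hsq1⟩

open McCurleyStechkin in
/-- **The same in the shape of `AtMostOneZeroInClosedRegion 9.645908801 10` with the two extra
hypotheses `Im s₁ = Im s₂ = 0`** — i.e. `McCurley1984_theorem1_closed` holds for real zeros.
[cite: McCurley1984ZFR, Theorem 1 (p. 8)] -/
theorem mccurley1984_theorem1_closed_of_im_eq_zero :
    ∀ (q : ℕ) [NeZero q], 3 ≤ q →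
      ∀ (χ₁ χ₂ : DirichletCharacter ℂ q) (s₁ s₂ : ℂ), s₁.im = 0 → s₂.im = 0 → s₁ ≠ 1 → s₂ ≠ 1 →
        1 - 1 / (9.645908801 * Real.log (max (max (q : ℝ) ((q : ℝ) * |s₁.im|)) 10)) ≤ s₁.re →
        1 - 1 / (9.645908801 * Real.log (max (max (q : ℝ) ((q : ℝ) * |s₂.im|)) 10)) ≤ s₂.re →
        χ₁.LFunction s₁ = 0 → χ₂.LFunction s₂ = 0 →
        (χ₁ = χ₂ ∧ s₁ = s₂) ∧ s₁.im = 0 ∧ χ₁ ≠ 1 ∧ χ₁ ^ 2 = 1 := by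
  intro q _ hq χ₁ χ₂ s₁ s₂ hi₁ hi₂ hs₁ hs₂ hr₁ hr₂ hz₁ hz₂
  have hq0 : (0 : ℝ) ≤ q := by positivity
  have e₁ : s₁ = ((s₁.re : ℝ) : ℂ) := Complex.ext (by simp) (by simp [hi₁])
  have e₂ : s₂ = ((s₂.re : ℝ) : ℂ) := Complex.ext (by simp) (by simp [hi₂])
  rw [hi₁, abs_zero, mul_zero, max_eq_left hq0] at hr₁
  rw [hi₂, abs_zero, mul_zero, max_eq_left hq0] at hr₂
  have hs₁' : s₁.re ≠ 1 := fun h ↦ hs₁ (by rw [e₁, h]; simp)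
  have hs₂' : s₂.re ≠ 1 := fun h ↦ hs₂ (by rw [e₂, h]; simp)
  rw [e₁] at hz₁
  rw [e₂] at hz₂
  obtain ⟨⟨hχ, hs⟩, h1, hsq⟩ := mccurley1984_theorem1_realZeros hq χ₁ χ₂ hs₁' hs₂' hr₁ hr₂ hz₁ hz₂
  refine ⟨⟨hχ, ?_⟩, hi₁, h1, hsq⟩
  rw [e₁, e₂, hs]

end Literature.NumberTheory.LFunctions
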